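import Mathlib
import Literature.Probability.Percolation.QuadCrossingSquareModel
import Literature.Barriers.CriticalPhenomena.EmbeddingModulusUniquenessProofs
import Literature.Probability.RandomPlanarGeometry.ConformalRectangleProofs
import Literature.Probability.RandomPlanarGeometry.ChordalCurveFamily
import Literature.Probability.RandomPlanarGeometry.DiamondShearChart
import Literature.Analysis.OperatorTheory.CoerciveMinimumAnalytic
import Literature.Probability.RandomPlanarGeometry.UniformizingArcCorrespondence
import Literature.Probability.RandomPlanarGeometry.MoebiusMatching
import Literature.Probability.RandomPlanarGeometry.ShearModulusAnalytic
import HarnessLib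

/-!
# Ahlfors–Bers for Beffara's shears via the Dirichlet principle — `ShearCrossRatioAnalytic` HOLDS (re-homed proofs)

**Ahlfors–Bers for Beffara's shears — the named fact `Literature.Probability.RandomPlanarGeometry.ShearCrossRatioAnalytic`
(`ShearModulusAnalytic.lean`) HOLDS**: for every conformal rectangle `R'` there is `M : ℂ → ℝ`, real-analytic on the upper half-plane, such that
the conformal modulus (cross-ratio of the uniformizing data) of the sheared quadrilateral `φ_α R'` (`φ_α = moduliShear α`) equals `M α` for every
shear `α` with `Im α > 0` (L. Ahlfors, L. Bers, *Riemann's mapping theorem for variable metrics*, Ann. of Math. 72 (1960), Thm. 11 with Thm. 10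
[AhlforsBers1960]; Ahlfors, *Lectures on Quasiconformal Mappings*, Ch. V Thm. 5).  The in-tree proof AVOIDS quasiconformal theory: the modulus
is read through the Dirichlet energy / capacity of the rectangle (`ShearEnergyAnalytic`: the shear family's energy is real-analytic in `α`;
`ShearCapacityEq`, `RectCapacity`, `CapacityInvariant`: conformal invariance and the capacity of the uniformized rectangle; `RectUniformization`), and
the Kleban–Zagier function `λ_R` inverts capacity to cross-ratio analytically.  Kernel-checked; until now Summits-side only
(`Summits/CriticalPhenomena/CardyFormulaZ2/Theorems/CardySelfDualSegmentSegmentOpenStubShearCrossRatioAnalytic.lean`).  RE-HOMED into `Literature/`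
by the Hodge foundations lane (`lit-hodgefound`, seat p20, generation 38): verbatim DECLARATION-LEVEL ports of the 6 Summits modules
`…/Theorems/CardySelfDualSegmentSegmentOpenStub{ShearEnergyAnalytic (15), ShearCapacityEq (9), RectCapacity (14), CapacityInvariant (7),
RectUniformization (3), ShearCrossRatioAnalytic (4)}.lean`, namespace `Summit.CriticalPhenomena.CardyFormulaZ2.Theorems` re-rooted as
`Literature.Probability.RandomPlanarGeometry.ShearModulus` (sub-namespaces kept; in-tree `stub_…` names kept, they are proved theorems), followed
by the EXACT-name discharge `Literature.Probability.RandomPlanarGeometry.ShearCrossRatioAnalytic_holds`.  Theorem-only file: no definition, no new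
named fact (D-0026), no Summits import; built on the tree's Literature layer (`Probability/RandomPlanarGeometry/*`, `Barriers/CriticalPhenomena/*`
for `moduliShear`, `Analysis/*`) and Mathlib.  The Summits originals stay in place (transitional duplication).  WHAT THIS IS NOT: nothing about
Cardy's formula or crossing probabilities; this is the analytic dependence of a conformal modulus on a shear parameter.
-/

noncomputable section

/-!
## Part 1 — port of `Summits/CriticalPhenomena/CardyFormulaZ2/Theorems/CardySelfDualSegmentSegmentOpenStubShearEnergyAnalytic.lean` (15 declarations kept)

# Crux `SegmentOpen` , line `Sketch` — stub `stub_shearEnergyAnalytic`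

The infimum `E(α)` of the `α`-anisotropic Dirichlet energies over the admissible test functions
of a conformal rectangle `R'` is real-analytic on `{im α > 0}`: (A) Kato's lemma
`Literature.Analysis.OperatorTheory.analyticAt_sInf_quadratic` (analytic dependence of a coercive
quadratic minimum on its coefficients; Lax–Milgram + `analyticAt_inverse`); (B) realization on
`L²(μ) ⊕ L²(μ)`, `μ` = Lebesgue measure on the carrier (classes of `(∂ₓU, ∂_yU)`), by an operator
family `T α` whose form is the pointwise matrix `[[b + a²/b, −a/b], [−a/b, 1/b]]` (`a = re α`,
`b = im α`), coercive with constant `b / (1 + a² + b²)`, over the submodule of gradients of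
finite-energy functions vanishing near both arcs; (C) composition in `α`. Theorems only: the
operator family is produced existentially (`exists_shearOp`) and the submodule is built inside
the final proof.

(Verbatim declaration-level port — the declarations listed in the Part header count — of the Summits-side module of the CardyFormulaZ2
tree; route / stub bookkeeping in the text above is historical.)
-/

section Part1

namespace Literature.Probability.RandomPlanarGeometry.ShearModulus

open Literature.Probability Literature.Barriers.CriticalPhenomena
open Literature.Probability.RandomPlanarGeometry (ConformalRectangle ConformalEquiv MarkedDomain)
open _root_.Filter _root_.Set _root_.Topology _root_.MeasureTheory
open _root_.UpperHalfPlane (upperHalfPlaneSet)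
open scoped _root_.InnerProductSpace

namespace ShearEnergyAnalytic

/-- Coercivity inequality: `b/(1+a²+b²) (x²+y²) ≤ (b + a²/b) x² − (a/b) 2t + y²/b` if `|t| ≤ xy`.
[cite: AhlforsBers1960, Thm. 11 (analytic dependence of the modulus; here via the Dirichlet principle — bookkeeping)] -/
theorem quad_bound (a b x y t : ℝ) (hb : 0 < b) (ht : |t| ≤ x * y) :
    b / (1 + a ^ 2 + b ^ 2) * (x ^ 2 + y ^ 2) ≤
      (b + a ^ 2 / b) * x ^ 2 + -(a / b) * (t + t) + b⁻¹ * y ^ 2 := by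
  have hat : a * t ≤ |a| * (x * y) :=
    (le_abs_self _).trans (by rw [abs_mul]; exact mul_le_mul_of_nonneg_left ht (abs_nonneg a))
  have hDpos : 0 < 1 + a ^ 2 + b ^ 2 := by positivity
  have key' : ∀ A : ℝ, b ^ 2 * (x ^ 2 + y ^ 2) ≤
      (1 + A ^ 2 + b ^ 2) * (b ^ 2 * x ^ 2 + y ^ 2 - 2 * A * x * y + A ^ 2 * x ^ 2) := by
    intro A
    have iden : (1 + A ^ 2) * ((1 + A ^ 2 + b ^ 2) *
        (b ^ 2 * x ^ 2 + y ^ 2 - 2 * A * x * y + A ^ 2 * x ^ 2) - b ^ 2 * (x ^ 2 + y ^ 2)) =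
        ((1 + A ^ 2) * y - A * (1 + A ^ 2 + b ^ 2) * x) ^ 2 + b ^ 4 * x ^ 2 := by ring
    have hsos : 0 ≤ ((1 + A ^ 2) * y - A * (1 + A ^ 2 + b ^ 2) * x) ^ 2 + b ^ 4 * x ^ 2 := by
      positivity
    rw [← iden] at hsos
    have := (mul_nonneg_iff_of_pos_left (by positivity : (0 : ℝ) < 1 + A ^ 2)).1 hsos
    linarith
  have key := key' |a|
  rw [sq_abs] at key
  have hb' : b ≠ 0 := hb.ne'
  have hQ : (b + a ^ 2 / b) * x ^ 2 + -(a / b) * (t + t) + b⁻¹ * y ^ 2 =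
      (b ^ 2 * x ^ 2 + a ^ 2 * x ^ 2 - 2 * a * t + y ^ 2) / b := by
    field_simp; ring
  rw [hQ, le_div_iff₀ hb, div_mul_eq_mul_div, div_mul_eq_mul_div, div_le_iff₀ hDpos]
  have h2 : (1 + a ^ 2 + b ^ 2) * (a * t) ≤ (1 + a ^ 2 + b ^ 2) * (|a| * (x * y)) :=
    mul_le_mul_of_nonneg_left hat hDpos.le
  nlinarith [key, h2]

/-- **The sheared energy operator family** on `L²(μ) ⊕ L²(μ)`: there is
`T : ℂ → (W →L[ℝ] W)`, `W = WithLp 2 (Lp ℝ 2 μ × Lp ℝ 2 μ)`, with every `T α` symmetric,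
`T α` coercive (constant `im α / (1 + re α² + im α²)`) for `im α > 0`, `α ↦ T α` real-analytic
off the real axis, and quadratic form `⟪T α k, k⟫ = ∫ im α p² + (q − re α p)² / im α ∂μ` at any
`k` representing `(p, q)`. Construction: `T α = c₁(α) M₁ + c₂(α) M₂ + c₃(α) M₃` with the blocks
`(f, g) ↦ (f, 0), (g, f), (0, g)` and `(c₁, c₂, c₃) = (b + a²/b, −a/b, 1/b)`.
[cite: AhlforsBers1960, Thm. 11 (analytic dependence of the modulus; here via the Dirichlet principle — bookkeeping)] -/
theorem exists_shearOp (μ : Measure ℂ) :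
    ∃ T : ℂ → (WithLp 2 (Lp ℝ 2 μ × Lp ℝ 2 μ) →L[ℝ] WithLp 2 (Lp ℝ 2 μ × Lp ℝ 2 μ)),
      (∀ α u v, ⟪T α u, v⟫_ℝ = ⟪u, T α v⟫_ℝ) ∧
      (∀ α : ℂ, 0 < α.im → ∃ c : ℝ, 0 < c ∧ ∀ u, c * ‖u‖ ^ 2 ≤ ⟪T α u, u⟫_ℝ) ∧
      (∀ α : ℂ, α.im ≠ 0 → AnalyticAt ℝ T α) ∧
      (∀ (α : ℂ) (p q : ℂ → ℝ), MemLp p 2 μ → MemLp q 2 μ →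
        ∀ k : WithLp 2 (Lp ℝ 2 μ × Lp ℝ 2 μ), ((k.fst : ℂ → ℝ) =ᵐ[μ] p) →
          ((k.snd : ℂ → ℝ) =ᵐ[μ] q) →
          ⟪T α k, k⟫_ℝ = ∫ z, (α.im * p z ^ 2 + (q z - α.re * p z) ^ 2 / α.im) ∂μ) := by
  let e := ((WithLp.prodContinuousLinearEquiv 2 ℝ (Lp ℝ 2 μ) (Lp ℝ 2 μ)).symm :
    Lp ℝ 2 μ × Lp ℝ 2 μ →L[ℝ] WithLp 2 (Lp ℝ 2 μ × Lp ℝ 2 μ))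
  let M₁ := e ∘L ContinuousLinearMap.inl ℝ (Lp ℝ 2 μ) (Lp ℝ 2 μ) ∘L
    WithLp.fstL 2 ℝ (Lp ℝ 2 μ) (Lp ℝ 2 μ)
  let M₂ := e ∘L (ContinuousLinearMap.inr ℝ (Lp ℝ 2 μ) (Lp ℝ 2 μ) ∘L
    WithLp.fstL 2 ℝ (Lp ℝ 2 μ) (Lp ℝ 2 μ) + ContinuousLinearMap.inl ℝ (Lp ℝ 2 μ) (Lp ℝ 2 μ) ∘L
      WithLp.sndL 2 ℝ (Lp ℝ 2 μ) (Lp ℝ 2 μ))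
  let M₃ := e ∘L ContinuousLinearMap.inr ℝ (Lp ℝ 2 μ) (Lp ℝ 2 μ) ∘L
    WithLp.sndL 2 ℝ (Lp ℝ 2 μ) (Lp ℝ 2 μ)
  let T : ℂ → (WithLp 2 (Lp ℝ 2 μ × Lp ℝ 2 μ) →L[ℝ] WithLp 2 (Lp ℝ 2 μ × Lp ℝ 2 μ)) :=
    fun α => (α.im + α.re ^ 2 / α.im) • M₁ + (-(α.re / α.im)) • M₂ + (α.im)⁻¹ • M₃
  have hT : ∀ (α : ℂ) (u v : WithLp 2 (Lp ℝ 2 μ × Lp ℝ 2 μ)), ⟪T α u, v⟫_ℝ =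
      (α.im + α.re ^ 2 / α.im) * ⟪u.fst, v.fst⟫_ℝ +
        (-(α.re / α.im)) * (⟪u.snd, v.fst⟫_ℝ + ⟪u.fst, v.snd⟫_ℝ) +
        (α.im)⁻¹ * ⟪u.snd, v.snd⟫_ℝ := by
    intro α u v
    simp [T, M₁, M₂, M₃, e, inner_add_left, real_inner_smul_left]
    ring
  refine ⟨T, fun α u v => ?_, fun α hα => ?_, fun α hα => ?_, fun α p q hp hq k hk1 hk2 => ?_⟩
  · -- symmetry
    rw [real_inner_comm (T α v) u, hT, hT, real_inner_comm u.fst v.fst,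
      real_inner_comm u.fst v.snd, real_inner_comm u.snd v.fst, real_inner_comm u.snd v.snd]
    ring
  · -- coercivity
    refine ⟨α.im / (1 + α.re ^ 2 + α.im ^ 2), by positivity, fun u => ?_⟩
    rw [hT, WithLp.prod_norm_sq_eq_of_L2, real_inner_self_eq_norm_sq,
      real_inner_self_eq_norm_sq, real_inner_comm u.fst u.snd]
    exact quad_bound α.re α.im ‖u.fst‖ ‖u.snd‖ ⟪u.fst, u.snd⟫_ℝ hα (abs_real_inner_le_norm _ _)
  · -- analyticity
    have hre : AnalyticAt ℝ (fun z : ℂ => z.re) α := Complex.reCLM.analyticAt α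
    have him : AnalyticAt ℝ (fun z : ℂ => z.im) α := Complex.imCLM.analyticAt α
    have h1 : AnalyticAt ℝ (fun z : ℂ => z.im + z.re ^ 2 / z.im) α :=
      him.add ((hre.pow 2).div him hα)
    have h2 : AnalyticAt ℝ (fun z : ℂ => -(z.re / z.im)) α := (hre.div him hα).neg
    have h3 : AnalyticAt ℝ (fun z : ℂ => (z.im)⁻¹) α := him.inv hα
    exact ((h1.smul analyticAt_const).add (h2.smul analyticAt_const)).add
      (h3.smul analyticAt_const)
  · -- the quadratic form: `⟪T α k, k⟫ = ∫ (c₁ p² + 2 c₂ p q + c₃ q²) = ∫ b p² + (q − a p)² / b`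
    have hI : ∀ (f g : Lp ℝ 2 μ) (p q : ℂ → ℝ), ((f : ℂ → ℝ) =ᵐ[μ] p) →
        ((g : ℂ → ℝ) =ᵐ[μ] q) → ⟪f, g⟫_ℝ = ∫ z, p z * q z ∂μ := by
      intro f g p q hf hg
      rw [MeasureTheory.L2.inner_def]
      refine integral_congr_ae ?_
      filter_upwards [hf, hg] with z h1 h2
      rw [h1, h2, Real.inner_apply]
    have ipp : Integrable (fun z => p z * p z) μ := hp.integrable_mul hp
    have ipq : Integrable (fun z => p z * q z) μ := hp.integrable_mul hq
    have iqp : Integrable (fun z => q z * p z) μ := hq.integrable_mul hp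
    have iqq : Integrable (fun z => q z * q z) μ := hq.integrable_mul hq
    rw [hT, hI _ _ _ _ hk1 hk1, hI _ _ _ _ hk2 hk1, hI _ _ _ _ hk1 hk2, hI _ _ _ _ hk2 hk2]
    have i1 : Integrable (fun z => (α.im + α.re ^ 2 / α.im) * (p z * p z)) μ := ipp.const_mul _
    have i2 : Integrable (fun z => (-(α.re / α.im)) * (q z * p z + p z * q z)) μ :=
      (iqp.add ipq).const_mul _
    have i3 : Integrable (fun z => (α.im)⁻¹ * (q z * q z)) μ := iqq.const_mul _
    have i23 : Integrable (fun z => (-(α.re / α.im)) * (q z * p z + p z * q z) +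
        (α.im)⁻¹ * (q z * q z)) μ := i2.add i3
    have e1 : ∫ z, (α.im * p z ^ 2 + (q z - α.re * p z) ^ 2 / α.im) ∂μ =
        ∫ z, ((α.im + α.re ^ 2 / α.im) * (p z * p z) + ((-(α.re / α.im)) *
          (q z * p z + p z * q z) + (α.im)⁻¹ * (q z * q z))) ∂μ :=
      integral_congr_ae (ae_of_all _ fun z => by ring)
    rw [e1, integral_add i1 i23, integral_add i2 i3, integral_const_mul, integral_const_mul,
      integral_const_mul, integral_add iqp ipq]
    ring

/-! #### Finite-energy `C¹` functions on an open set `Ω`, for a measure `μ` carried by `Ω` -/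

variable {Ω : Set ℂ} {μ : Measure ℂ}

/-- `C¹` functions on the open set `Ω` are differentiable at its points.
[cite: AhlforsBers1960, Thm. 11 (analytic dependence of the modulus; here via the Dirichlet principle — bookkeeping)] -/
theorem diffAt (hΩ : IsOpen Ω) {U : ℂ → ℝ} (hU : ContDiffOn ℝ 1 U Ω) {z : ℂ} (hz : z ∈ Ω) :
    DifferentiableAt ℝ U z :=
  (hU.differentiableOn one_ne_zero).differentiableAt (hΩ.mem_nhds hz)

/-- Finite energy is preserved under sums (`‖f + g‖² ≤ 2‖f‖² + 2‖g‖²`).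
[cite: AhlforsBers1960, Thm. 11 (analytic dependence of the modulus; here via the Dirichlet principle — bookkeeping)] -/
theorem energy_add (hΩ : IsOpen Ω) (hμ : ∀ᵐ z ∂μ, z ∈ Ω) {U V : ℂ → ℝ}
    (hU : ContDiffOn ℝ 1 U Ω) (hV : ContDiffOn ℝ 1 V Ω)
    (hUi : Integrable (fun z => ‖fderiv ℝ U z‖ ^ 2) μ)
    (hVi : Integrable (fun z => ‖fderiv ℝ V z‖ ^ 2) μ) :
    Integrable (fun z => ‖fderiv ℝ (U + V) z‖ ^ 2) μ := by
  refine Integrable.mono' ((hUi.const_mul 2).add (hVi.const_mul 2))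
    ((measurable_fderiv ℝ (U + V)).norm.pow_const 2).aestronglyMeasurable ?_
  filter_upwards [hμ] with z hz
  rw [norm_pow, norm_norm, fderiv_add (diffAt hΩ hU hz) (diffAt hΩ hV hz)]
  show _ ≤ 2 * ‖fderiv ℝ U z‖ ^ 2 + 2 * ‖fderiv ℝ V z‖ ^ 2
  have h1 : ‖fderiv ℝ U z + fderiv ℝ V z‖ ^ 2 ≤ (‖fderiv ℝ U z‖ + ‖fderiv ℝ V z‖) ^ 2 :=
    pow_le_pow_left₀ (norm_nonneg _) (norm_add_le _ _) 2
  nlinarith [sq_nonneg (‖fderiv ℝ U z‖ - ‖fderiv ℝ V z‖)]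

/-- Finite energy is preserved under scalar multiples.
[cite: AhlforsBers1960, Thm. 11 (analytic dependence of the modulus; here via the Dirichlet principle — bookkeeping)] -/
theorem energy_smul (hΩ : IsOpen Ω) (hμ : ∀ᵐ z ∂μ, z ∈ Ω) {U : ℂ → ℝ} (hU : ContDiffOn ℝ 1 U Ω)
    (hUi : Integrable (fun z => ‖fderiv ℝ U z‖ ^ 2) μ) (c : ℝ) :
    Integrable (fun z => ‖fderiv ℝ (c • U) z‖ ^ 2) μ := by
  refine (hUi.const_mul (c ^ 2)).congr ?_
  filter_upwards [hμ] with z hz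
  rw [fderiv_const_smul (diffAt hΩ hU hz) c, norm_smul, mul_pow, Real.norm_eq_abs, sq_abs]

/-- Finite energy is preserved under differences.
[cite: AhlforsBers1960, Thm. 11 (analytic dependence of the modulus; here via the Dirichlet principle — bookkeeping)] -/
theorem energy_sub (hΩ : IsOpen Ω) (hμ : ∀ᵐ z ∂μ, z ∈ Ω) {U V : ℂ → ℝ}
    (hU : ContDiffOn ℝ 1 U Ω) (hV : ContDiffOn ℝ 1 V Ω)
    (hUi : Integrable (fun z => ‖fderiv ℝ U z‖ ^ 2) μ)
    (hVi : Integrable (fun z => ‖fderiv ℝ V z‖ ^ 2) μ) :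
    Integrable (fun z => ‖fderiv ℝ (U - V) z‖ ^ 2) μ := by
  have h1 : ContDiffOn ℝ 1 ((-1 : ℝ) • V) Ω := hV.const_smul (-1 : ℝ)
  have h2 := energy_add hΩ hμ hU h1 hUi (energy_smul hΩ hμ hV hVi (-1))
  rwa [neg_one_smul, ← sub_eq_add_neg] at h2

/-- Boundary conditions (`U = c` on a neighbourhood of `A`, inside `Ω`) add.
[cite: AhlforsBers1960, Thm. 11 (analytic dependence of the modulus; here via the Dirichlet principle — bookkeeping)] -/
theorem bc_add {A Ω : Set ℂ} {c d : ℝ} {U V : ℂ → ℝ}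
    (hU : ∃ O : Set ℂ, IsOpen O ∧ A ⊆ O ∧ ∀ z ∈ O ∩ Ω, U z = c)
    (hV : ∃ O : Set ℂ, IsOpen O ∧ A ⊆ O ∧ ∀ z ∈ O ∩ Ω, V z = d) :
    ∃ O : Set ℂ, IsOpen O ∧ A ⊆ O ∧ ∀ z ∈ O ∩ Ω, (U + V) z = c + d := by
  obtain ⟨O, hO, hsub, hval⟩ := hU
  obtain ⟨O', hO', hsub', hval'⟩ := hV
  exact ⟨O ∩ O', hO.inter hO', subset_inter hsub hsub', fun z hz => by
    rw [Pi.add_apply, hval z ⟨hz.1.1, hz.2⟩, hval' z ⟨hz.1.2, hz.2⟩]⟩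

/-- Boundary conditions scale.
[cite: AhlforsBers1960, Thm. 11 (analytic dependence of the modulus; here via the Dirichlet principle — bookkeeping)] -/
theorem bc_smul {A Ω : Set ℂ} {c : ℝ} {U : ℂ → ℝ}
    (hU : ∃ O : Set ℂ, IsOpen O ∧ A ⊆ O ∧ ∀ z ∈ O ∩ Ω, U z = c) (s : ℝ) :
    ∃ O : Set ℂ, IsOpen O ∧ A ⊆ O ∧ ∀ z ∈ O ∩ Ω, (s • U) z = s * c := by
  obtain ⟨O, hO, hsub, hval⟩ := hU
  exact ⟨O, hO, hsub, fun z hz => by rw [Pi.smul_apply, hval z hz, smul_eq_mul]⟩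

/-- Boundary conditions subtract.
[cite: AhlforsBers1960, Thm. 11 (analytic dependence of the modulus; here via the Dirichlet principle — bookkeeping)] -/
theorem bc_sub {A Ω : Set ℂ} {c d : ℝ} {U V : ℂ → ℝ}
    (hU : ∃ O : Set ℂ, IsOpen O ∧ A ⊆ O ∧ ∀ z ∈ O ∩ Ω, U z = c)
    (hV : ∃ O : Set ℂ, IsOpen O ∧ A ⊆ O ∧ ∀ z ∈ O ∩ Ω, V z = d) :
    ∃ O : Set ℂ, IsOpen O ∧ A ⊆ O ∧ ∀ z ∈ O ∩ Ω, (U - V) z = c - d := by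
  have := bc_add hU (bc_smul hV (-1))
  rwa [neg_one_smul, ← sub_eq_add_neg, neg_one_mul, ← sub_eq_add_neg] at this

/-- Directional derivatives of finite-energy functions are square integrable.
[cite: AhlforsBers1960, Thm. 11 (analytic dependence of the modulus; here via the Dirichlet principle — bookkeeping)] -/
theorem memLp_fderiv {U : ℂ → ℝ} (hUi : Integrable (fun z => ‖fderiv ℝ U z‖ ^ 2) μ) (v : ℂ)
    (hv : ‖v‖ ≤ 1) : MemLp (fun z => fderiv ℝ U z v) 2 μ := by
  rw [memLp_two_iff_integrable_sq (measurable_fderiv_apply_const ℝ U v).aestronglyMeasurable]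
  refine Integrable.mono' hUi
    ((measurable_fderiv_apply_const ℝ U v).pow_const 2).aestronglyMeasurable
    (Eventually.of_forall fun z => ?_)
  rw [norm_pow, Real.norm_eq_abs, sq_abs]
  have h' : |fderiv ℝ U z v| ≤ ‖fderiv ℝ U z‖ := by
    rw [← Real.norm_eq_abs]; nlinarith [norm_nonneg (fderiv ℝ U z), (fderiv ℝ U z).le_opNorm v]
  exact sq_le_sq' (abs_le.1 h').1 (abs_le.1 h').2

/-- Representation of directional derivatives by `L²` classes is additive.
[cite: AhlforsBers1960, Thm. 11 (analytic dependence of the modulus; here via the Dirichlet principle — bookkeeping)] -/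
theorem rep_add (hΩ : IsOpen Ω) (hμ : ∀ᵐ z ∂μ, z ∈ Ω) {U V : ℂ → ℝ} {f g : Lp ℝ 2 μ} {v : ℂ}
    (hU : ContDiffOn ℝ 1 U Ω) (hV : ContDiffOn ℝ 1 V Ω)
    (hf : (f : ℂ → ℝ) =ᵐ[μ] fun z => fderiv ℝ U z v)
    (hg : (g : ℂ → ℝ) =ᵐ[μ] fun z => fderiv ℝ V z v) :
    ((f + g : Lp ℝ 2 μ) : ℂ → ℝ) =ᵐ[μ] fun z => fderiv ℝ (U + V) z v := by
  filter_upwards [Lp.coeFn_add f g, hf, hg, hμ] with z h1 h2 h3 hz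
  rw [h1, Pi.add_apply, h2, h3, fderiv_add (diffAt hΩ hU hz) (diffAt hΩ hV hz), add_apply]

/-- Representation of directional derivatives by `L²` classes is homogeneous.
[cite: AhlforsBers1960, Thm. 11 (analytic dependence of the modulus; here via the Dirichlet principle — bookkeeping)] -/
theorem rep_smul (hΩ : IsOpen Ω) (hμ : ∀ᵐ z ∂μ, z ∈ Ω) {U : ℂ → ℝ} {f : Lp ℝ 2 μ} {v : ℂ}
    (hU : ContDiffOn ℝ 1 U Ω) (c : ℝ) (hf : (f : ℂ → ℝ) =ᵐ[μ] fun z => fderiv ℝ U z v) :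
    ((c • f : Lp ℝ 2 μ) : ℂ → ℝ) =ᵐ[μ] fun z => fderiv ℝ (c • U) z v := by
  filter_upwards [Lp.coeFn_smul c f, hf, hμ] with z h1 h2 hz
  rw [h1, Pi.smul_apply, h2, fderiv_const_smul (diffAt hΩ hU hz) c, smul_apply]

variable (μ) in
/-- The zero class represents the derivatives of the zero function.
[cite: AhlforsBers1960, Thm. 11 (analytic dependence of the modulus; here via the Dirichlet principle — bookkeeping)] -/
theorem rep_zero (v : ℂ) :
    ((0 : Lp ℝ 2 μ) : ℂ → ℝ) =ᵐ[μ] fun z => fderiv ℝ (0 : ℂ → ℝ) z v := by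
  filter_upwards [Lp.coeFn_zero ℝ 2 μ] with z hz
  rw [hz, fderiv_zero]; rfl

/-- Every finite-energy function has a representative of its gradient in `L²(μ) ⊕ L²(μ)`.
[cite: AhlforsBers1960, Thm. 11 (analytic dependence of the modulus; here via the Dirichlet principle — bookkeeping)] -/
theorem exists_rep {U : ℂ → ℝ} (hUi : Integrable (fun z => ‖fderiv ℝ U z‖ ^ 2) μ) :
    ∃ k : WithLp 2 (Lp ℝ 2 μ × Lp ℝ 2 μ), ((k.fst : ℂ → ℝ) =ᵐ[μ] fun z => fderiv ℝ U z 1) ∧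
      ((k.snd : ℂ → ℝ) =ᵐ[μ] fun z => fderiv ℝ U z Complex.I) :=
  ⟨WithLp.toLp 2 ((memLp_fderiv hUi 1 (by simp)).toLp _,
      (memLp_fderiv hUi Complex.I (by simp)).toLp _),
    (memLp_fderiv hUi 1 (by simp)).coeFn_toLp, (memLp_fderiv hUi Complex.I (by simp)).coeFn_toLp⟩

end ShearEnergyAnalytic

open ShearEnergyAnalytic in
/-- **Stub `stub_shearEnergyAnalytic` (AN) of line `Sketch`.** For every conformal rectangle `R'`,
the infimum `E(α)` of the `α`-anisotropic Dirichlet energies over the admissible test functions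
of `R'` (`C¹` on the carrier, finite energy, `0` near the arc `0`, `1` near the arc `2`) is
real-analytic on `{im α > 0}`. Proof: with `T` from `exists_shearOp` (`μ` = Lebesgue measure on
the carrier), `b` a representative of `∇U₀` for one admissible `U₀` and `K` the submodule of
representatives of gradients of finite-energy functions vanishing near both arcs, the set of
admissible energies is `{⟪T α (b + k), b + k⟫ : k ∈ K}` (`U ↦ U − U₀`, `V ↦ U₀ + V`); conclude by
Kato's lemma `Literature.Analysis.OperatorTheory.analyticAt_sInf_quadratic` (an empty admissible
class gives the constant `sInf ∅ = 0`).
[cite: AhlforsBers1960, Thm. 11 (analytic dependence of the modulus; here via the Dirichlet principle — bookkeeping)] -/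
theorem stub_shearEnergyAnalytic :
    ∀ R' : ConformalRectangle,
      AnalyticOnNhd ℝ (fun α : ℂ => sInf {e : ℝ | ∃ U : ℂ → ℝ,
          (ContDiffOn ℝ 1 U R'.carrier ∧
            IntegrableOn (fun z => ‖fderiv ℝ U z‖ ^ 2) R'.carrier ∧
            (∃ O : Set ℂ, IsOpen O ∧ R'.arc 0 ⊆ O ∧ ∀ z ∈ O ∩ R'.carrier, U z = 0) ∧
            (∃ O : Set ℂ, IsOpen O ∧ R'.arc 2 ⊆ O ∧ ∀ z ∈ O ∩ R'.carrier, U z = 1)) ∧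
          e = ∫ z in R'.carrier, (α.im * (fderiv ℝ U z 1) ^ 2 +
            (fderiv ℝ U z Complex.I - α.re * fderiv ℝ U z 1) ^ 2 / α.im)})
        {α : ℂ | 0 < α.im} := by
  intro R' α₀ hα₀
  have hΩ : IsOpen R'.carrier := R'.isOpen
  have hμ : ∀ᵐ z ∂(volume.restrict R'.carrier), z ∈ R'.carrier :=
    ae_restrict_mem hΩ.measurableSet
  by_cases hne : ∃ U₀ : ℂ → ℝ, ContDiffOn ℝ 1 U₀ R'.carrier ∧
      IntegrableOn (fun z => ‖fderiv ℝ U₀ z‖ ^ 2) R'.carrier ∧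
      (∃ O : Set ℂ, IsOpen O ∧ R'.arc 0 ⊆ O ∧ ∀ z ∈ O ∩ R'.carrier, U₀ z = 0) ∧
      (∃ O : Set ℂ, IsOpen O ∧ R'.arc 2 ⊆ O ∧ ∀ z ∈ O ∩ R'.carrier, U₀ z = 1)
  swap
  · -- empty admissible class: the function is constantly `sInf ∅ = 0`
    refine (analyticAt_const (v := (0 : ℝ))).congr (Eventually.of_forall fun α => ?_)
    symm
    convert Real.sInf_empty using 2
    exact Set.eq_empty_of_forall_notMem fun e ⟨U, hU, _⟩ => hne ⟨U, hU⟩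
  obtain ⟨U₀, h₀, h₀i, h₀0, h₀2⟩ := hne
  obtain ⟨T, hTs, hTc, hTa, hTe⟩ := exists_shearOp (volume.restrict R'.carrier)
  obtain ⟨b, hb1, hb2⟩ := exists_rep h₀i
  -- `K`: representatives of gradients of finite-energy functions vanishing near both arcs
  let K : Submodule ℝ (WithLp 2 (Lp ℝ 2 (volume.restrict R'.carrier) ×
      Lp ℝ 2 (volume.restrict R'.carrier))) :=
    { carrier := {k | ∃ V : ℂ → ℝ, (ContDiffOn ℝ 1 V R'.carrier ∧
          IntegrableOn (fun z => ‖fderiv ℝ V z‖ ^ 2) R'.carrier) ∧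
        ((∃ O : Set ℂ, IsOpen O ∧ R'.arc 0 ⊆ O ∧ ∀ z ∈ O ∩ R'.carrier, V z = 0) ∧
          (∃ O : Set ℂ, IsOpen O ∧ R'.arc 2 ⊆ O ∧ ∀ z ∈ O ∩ R'.carrier, V z = 0)) ∧
        ((k.fst : ℂ → ℝ) =ᵐ[volume.restrict R'.carrier] fun z => fderiv ℝ V z 1) ∧
        ((k.snd : ℂ → ℝ) =ᵐ[volume.restrict R'.carrier] fun z => fderiv ℝ V z Complex.I)}
      add_mem' := by
        rintro k k' ⟨V, ⟨hV, hVi⟩, ⟨hV0, hV2⟩, hk1, hk2⟩ ⟨V', ⟨hV', hVi'⟩, ⟨hV0', hV2'⟩, hk1', hk2'⟩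
        exact ⟨V + V', ⟨hV.add hV', energy_add hΩ hμ hV hV' hVi hVi'⟩,
          ⟨by simpa using bc_add hV0 hV0', by simpa using bc_add hV2 hV2'⟩,
          rep_add hΩ hμ hV hV' hk1 hk1', rep_add hΩ hμ hV hV' hk2 hk2'⟩
      zero_mem' := ⟨0, ⟨contDiffOn_const, by simp [fderiv_zero]⟩,
        ⟨⟨univ, isOpen_univ, subset_univ _, fun _ _ => rfl⟩,
          ⟨univ, isOpen_univ, subset_univ _, fun _ _ => rfl⟩⟩,
        rep_zero _ 1, rep_zero _ Complex.I⟩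
      smul_mem' := by
        rintro c k ⟨V, ⟨hV, hVi⟩, ⟨hV0, hV2⟩, hk1, hk2⟩
        exact ⟨c • V, ⟨hV.const_smul c, energy_smul hΩ hμ hV hVi c⟩,
          ⟨by simpa using bc_smul hV0 c, by simpa using bc_smul hV2 c⟩,
          rep_smul hΩ hμ hV c hk1, rep_smul hΩ hμ hV c hk2⟩ }
  refine (Literature.Analysis.OperatorTheory.analyticAt_sInf_quadratic K b T α₀ (hTa α₀ hα₀.ne')
    hTs (hTc α₀ hα₀)).congr (Eventually.of_forall fun α => ?_)
  show sInf _ = sInf _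
  congr 1
  ext e
  constructor
  · -- `k ∈ K`, represented by `V`: the admissible function `U₀ + V`
    rintro ⟨k, hk, rfl⟩
    obtain ⟨V, ⟨hV, hVi⟩, ⟨hV0, hV2⟩, hk1, hk2⟩ := hk
    have hUi := energy_add hΩ hμ h₀ hV h₀i hVi
    exact ⟨U₀ + V, ⟨h₀.add hV, hUi, by simpa using bc_add h₀0 hV0, by simpa using bc_add h₀2 hV2⟩,
      hTe α _ _ (memLp_fderiv hUi 1 (by simp)) (memLp_fderiv hUi Complex.I (by simp)) (b + k)
        (rep_add hΩ hμ h₀ hV hb1 hk1) (rep_add hΩ hμ h₀ hV hb2 hk2)⟩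
  · -- an admissible `U`: `k` a representative of `∇(U − U₀)`
    rintro ⟨U, ⟨hU, hUi, hU0, hU2⟩, rfl⟩
    have hV : ContDiffOn ℝ 1 (U - U₀) R'.carrier := hU.sub h₀
    have hVi := energy_sub hΩ hμ hU h₀ hUi h₀i
    obtain ⟨k, hk1, hk2⟩ := exists_rep hVi
    have hr1 := rep_add hΩ hμ h₀ hV hb1 hk1
    have hr2 := rep_add hΩ hμ h₀ hV hb2 hk2
    rw [add_sub_cancel] at hr1 hr2
    exact ⟨k, ⟨U - U₀, ⟨hV, hVi⟩, ⟨by simpa using bc_sub hU0 h₀0,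
      by simpa using bc_sub hU2 h₀2⟩, hk1, hk2⟩,
      (hTe α _ _ (memLp_fderiv hUi 1 (by simp)) (memLp_fderiv hUi Complex.I (by simp)) (b + k)
        hr1 hr2).symm⟩

end Literature.Probability.RandomPlanarGeometry.ShearModulus

end Part1

/-!
## Part 2 — port of `Summits/CriticalPhenomena/CardyFormulaZ2/Theorems/CardySelfDualSegmentSegmentOpenStubShearCapacityEq.lean` (9 declarations kept)

# Crux `SegmentOpen` , line `Sketch` — stub `stub_shearCapacity_eq`

The set of Dirichlet energies of the admissible test functions of Beffara's sheared quad
`φ_α R'` equals the set of `α`-anisotropic energies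
`∫_{R'} im α (∂ₓV)² + (∂_yV − re α ∂ₓV)² / im α` of the admissible test functions `V` of `R'`.
This is the linear change of variables `V = U ∘ φ_α`: the shear `φ_α = moduliShear α`
(`x + iy ↦ x + y re α + i y im α`) is an `ℝ`-linear automorphism of `ℂ` with matrix
`[[1, re α], [0, im α]]` and Jacobian `im α`, and `ℂ` is Euclidean in the coordinates `(re, im)`,
so that `im α · ‖∇U (φ_α z)‖² = im α (∂ₓV z)² + (∂_yV z − re α ∂ₓV z)² / im α`.

(Verbatim declaration-level port — the declarations listed in the Part header count — of the Summits-side module of the CardyFormulaZ2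
tree; route / stub bookkeeping in the text above is historical.)
-/

section Part2

namespace Literature.Probability.RandomPlanarGeometry.ShearModulus

open Literature.Probability Literature.Barriers.CriticalPhenomena
open Literature.Probability.RandomPlanarGeometry (ConformalRectangle ConformalEquiv MarkedDomain)
open _root_.Filter _root_.Set _root_.Topology _root_.MeasureTheory
open _root_.UpperHalfPlane (upperHalfPlaneSet)

/-- The shear `φ_α` (`im α ≠ 0`) is an `ℝ`-linear automorphism of `ℂ` with determinant `im α`
(matrix `[[1, re α], [0, im α]]` in the basis `(1, i)`).
[cite: AhlforsBers1960, Thm. 11 (analytic dependence of the modulus; here via the Dirichlet principle — bookkeeping)] -/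
private theorem exists_shearCLE (α : ℂ) (hα : α.im ≠ 0) :
    ∃ L : ℂ ≃L[ℝ] ℂ, ⇑L = moduliShear α ∧ (L : ℂ →L[ℝ] ℂ).det = α.im := by
  let L : ℂ ≃L[ℝ] ℂ :=
    { toFun := moduliShear α
      invFun := moduliShear ((Complex.I - (α.re : ℂ)) / (α.im : ℂ))
      map_add' := fun z w => by
        apply Complex.ext <;> simp [moduliShear] <;> ring
      map_smul' := fun c z => by
        apply Complex.ext <;> simp [moduliShear] <;> ring
      left_inv := (shearHomeomorph α hα).left_inv
      right_inv := (shearHomeomorph α hα).right_inv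
      continuous_toFun := continuous_moduliShear α
      continuous_invFun := continuous_moduliShear _ }
  have hL : ⇑L = moduliShear α := rfl
  refine ⟨L, hL, ?_⟩
  change LinearMap.det ((L : ℂ →L[ℝ] ℂ) : ℂ →ₗ[ℝ] ℂ) = α.im
  rw [← LinearMap.det_toMatrix Complex.basisOneI, Matrix.det_fin_two]
  simp [LinearMap.toMatrix_apply, hL]

/-- `ℂ` is Euclidean in the coordinates `(re, im)`: the operator norm of a real-linear functional
`ℓ` on `ℂ` satisfies `‖ℓ‖² = ℓ(1)² + ℓ(i)²`.
[cite: AhlforsBers1960, Thm. 11 (analytic dependence of the modulus; here via the Dirichlet principle — bookkeeping)] -/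
private theorem opNorm_sq_eq (ℓ : ℂ →L[ℝ] ℝ) :
    ‖ℓ‖ ^ 2 = (ℓ 1) ^ 2 + (ℓ Complex.I) ^ 2 := by
  obtain ⟨v, rfl⟩ := (InnerProductSpace.toDual ℝ ℂ).surjective ℓ
  rw [LinearIsometryEquiv.norm_map, InnerProductSpace.toDual_apply_apply,
    InnerProductSpace.toDual_apply_apply, Complex.inner, Complex.inner, Complex.sq_norm,
    Complex.normSq_apply]
  simp
  ring

/-- Chain rule for `U ∘ L` at a point of the open set `S`, `U` being `C¹` on `L '' S`.
[cite: AhlforsBers1960, Thm. 11 (analytic dependence of the modulus; here via the Dirichlet principle — bookkeeping)] -/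
private theorem fderiv_comp_cle (L : ℂ ≃L[ℝ] ℂ) {S : Set ℂ} (hS : IsOpen S) {U : ℂ → ℝ}
    (hU : ContDiffOn ℝ 1 U (L '' S)) {z : ℂ} (hz : z ∈ S) :
    fderiv ℝ (U ∘ L) z = (fderiv ℝ U (L z)).comp (L : ℂ →L[ℝ] ℂ) := by
  have hopen : IsOpen (L '' S) := L.isOpenMap S hS
  have hd : DifferentiableAt ℝ U (L z) :=
    hU.differentiableOn_one.differentiableAt (hopen.mem_nhds (mem_image_of_mem L hz))
  rw [fderiv_comp z hd L.differentiableAt, L.fderiv]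

/-- The `α`-anisotropic integrand of `V = U ∘ φ_α` at `z` is `im α · ‖∇U (φ_α z)‖²`
(`ℓ = fderiv ℝ U (φ_α z)`, `fderiv ℝ V z = ℓ ∘L φ_α`, `φ_α 1 = 1`, `φ_α i = α`).
[cite: AhlforsBers1960, Thm. 11 (analytic dependence of the modulus; here via the Dirichlet principle — bookkeeping)] -/
private theorem integrand_eq {α : ℂ} (hα : α.im ≠ 0) (L : ℂ ≃L[ℝ] ℂ) (hL : ⇑L = moduliShear α)
    (ℓ : ℂ →L[ℝ] ℝ) :
    α.im * (ℓ.comp (L : ℂ →L[ℝ] ℂ) 1) ^ 2 +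
        (ℓ.comp (L : ℂ →L[ℝ] ℂ) Complex.I - α.re * ℓ.comp (L : ℂ →L[ℝ] ℂ) 1) ^ 2 / α.im =
      α.im * ‖ℓ‖ ^ 2 := by
  have hℓα : ℓ α = α.re * ℓ 1 + α.im * ℓ Complex.I := by
    conv_lhs => rw [← Complex.re_add_im α]
    rw [map_add, show ((α.re : ℂ)) = α.re • (1 : ℂ) by rw [Complex.real_smul, mul_one],
      show (α.im : ℂ) * Complex.I = α.im • Complex.I from Complex.real_smul.symm,
      map_smul, map_smul, smul_eq_mul, smul_eq_mul]
  simp only [ContinuousLinearMap.comp_apply, ContinuousLinearEquiv.coe_coe, hL, moduliShear_one,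
    moduliShear_I, hℓα, opNorm_sq_eq ℓ]
  field_simp
  ring

/-- Change of variables `w = φ_α z` in the Dirichlet energy: for `U` of class `C¹` on `φ_α '' S`
(`S` open), `∫_{φ_α S} ‖∇U‖² = ∫_S im α (∂ₓV)² + (∂_yV − re α ∂ₓV)² / im α`, `V = U ∘ φ_α`.
[cite: AhlforsBers1960, Thm. 11 (analytic dependence of the modulus; here via the Dirichlet principle — bookkeeping)] -/
private theorem energy_eq {α : ℂ} (hα : 0 < α.im) (L : ℂ ≃L[ℝ] ℂ) (hL : ⇑L = moduliShear α)
    (hdet : (L : ℂ →L[ℝ] ℂ).det = α.im) {S : Set ℂ} (hS : IsOpen S) {U : ℂ → ℝ}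
    (hU : ContDiffOn ℝ 1 U (L '' S)) :
    ∫ w in L '' S, ‖fderiv ℝ U w‖ ^ 2 =
      ∫ z in S, (α.im * (fderiv ℝ (U ∘ L) z 1) ^ 2 +
        (fderiv ℝ (U ∘ L) z Complex.I - α.re * fderiv ℝ (U ∘ L) z 1) ^ 2 / α.im) := by
  rw [integral_image_eq_integral_abs_det_fderiv_smul volume hS.measurableSet
    (fun x _ => L.hasFDerivWithinAt) L.injective.injOn]
  refine setIntegral_congr_fun hS.measurableSet fun z hz => ?_
  simp only [hdet, abs_of_pos hα, smul_eq_mul]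
  rw [fderiv_comp_cle L hS hU hz, integrand_eq hα.ne' L hL]

/-- Square-integrability of the gradient transfers along the linear change of variables
`V = U ∘ φ_α` (two-sided comparison `‖∇V z‖ ≤ ‖φ_α‖ ‖∇U (φ_α z)‖`,
`‖∇U (φ_α z)‖ ≤ ‖φ_α⁻¹‖ ‖∇V z‖`, plus the change of variables with constant Jacobian `im α`).
[cite: AhlforsBers1960, Thm. 11 (analytic dependence of the modulus; here via the Dirichlet principle — bookkeeping)] -/
private theorem integrableOn_comp_iff {α : ℂ} (hα : 0 < α.im) (L : ℂ ≃L[ℝ] ℂ)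
    (hdet : (L : ℂ →L[ℝ] ℂ).det = α.im) {S : Set ℂ} (hS : IsOpen S) {U : ℂ → ℝ}
    (hU : ContDiffOn ℝ 1 U (L '' S)) :
    IntegrableOn (fun w => ‖fderiv ℝ U w‖ ^ 2) (L '' S) ↔
      IntegrableOn (fun z => ‖fderiv ℝ (U ∘ L) z‖ ^ 2) S := by
  rw [integrableOn_image_iff_integrableOn_abs_det_fderiv_smul volume hS.measurableSet
    (fun x _ => L.hasFDerivWithinAt) L.injective.injOn]
  simp only [hdet, abs_of_pos hα, smul_eq_mul]
  have hmeas₁ : AEStronglyMeasurable (fun z => ‖fderiv ℝ (U ∘ L) z‖ ^ 2) (volume.restrict S) :=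
    ((measurable_fderiv ℝ (U ∘ L)).norm.pow_const 2).aestronglyMeasurable
  have hmeas₂ : AEStronglyMeasurable (fun z => α.im * ‖fderiv ℝ U (L z)‖ ^ 2)
      (volume.restrict S) :=
    ((((measurable_fderiv ℝ U).comp L.continuous.measurable).norm.pow_const 2).const_mul
      α.im).aestronglyMeasurable
  have key : ∀ z ∈ S, fderiv ℝ (U ∘ L) z = (fderiv ℝ U (L z)).comp (L : ℂ →L[ℝ] ℂ) :=
    fun z hz => fderiv_comp_cle L hS hU hz
  have key' : ∀ z ∈ S, fderiv ℝ U (L z) = (fderiv ℝ (U ∘ L) z).comp (L.symm : ℂ →L[ℝ] ℂ) :=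
    fun z hz => by
      rw [key z hz, ContinuousLinearMap.comp_assoc, ContinuousLinearEquiv.coe_comp_coe_symm,
        ContinuousLinearMap.comp_id]
  constructor
  · intro h
    refine Integrable.mono' (h.integrable.const_mul (‖(L : ℂ →L[ℝ] ℂ)‖ ^ 2 / α.im)) hmeas₁ ?_
    filter_upwards [ae_restrict_mem hS.measurableSet] with z hz
    rw [Real.norm_of_nonneg (sq_nonneg _), key z hz]
    calc ‖(fderiv ℝ U (L z)).comp (L : ℂ →L[ℝ] ℂ)‖ ^ 2
        ≤ (‖fderiv ℝ U (L z)‖ * ‖(L : ℂ →L[ℝ] ℂ)‖) ^ 2 := by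
          gcongr
          exact ContinuousLinearMap.opNorm_comp_le _ _
      _ = ‖(L : ℂ →L[ℝ] ℂ)‖ ^ 2 / α.im * (α.im * ‖fderiv ℝ U (L z)‖ ^ 2) := by
          field_simp
  · intro h
    refine Integrable.mono' (h.integrable.const_mul (α.im * ‖(L.symm : ℂ →L[ℝ] ℂ)‖ ^ 2)) hmeas₂ ?_
    filter_upwards [ae_restrict_mem hS.measurableSet] with z hz
    rw [Real.norm_of_nonneg (by positivity), key' z hz]
    calc α.im * ‖(fderiv ℝ (U ∘ L) z).comp (L.symm : ℂ →L[ℝ] ℂ)‖ ^ 2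
        ≤ α.im * (‖fderiv ℝ (U ∘ L) z‖ * ‖(L.symm : ℂ →L[ℝ] ℂ)‖) ^ 2 := by
          gcongr
          exact ContinuousLinearMap.opNorm_comp_le _ _
      _ = α.im * ‖(L.symm : ℂ →L[ℝ] ℂ)‖ ^ 2 * ‖fderiv ℝ (U ∘ L) z‖ ^ 2 := by ring

/-- `C¹`-regularity transfers along the linear change of variables `V = U ∘ L`.
[cite: AhlforsBers1960, Thm. 11 (analytic dependence of the modulus; here via the Dirichlet principle — bookkeeping)] -/
private theorem contDiffOn_comp_iff (L : ℂ ≃L[ℝ] ℂ) {S : Set ℂ} {U : ℂ → ℝ} :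
    ContDiffOn ℝ 1 U (L '' S) ↔ ContDiffOn ℝ 1 (U ∘ L) S := by
  constructor
  · intro h
    exact (h.comp_continuousLinearMap (L : ℂ →L[ℝ] ℂ)).mono (subset_preimage_image _ _)
  · intro h
    rw [L.image_eq_preimage_symm]
    have h' := h.comp_continuousLinearMap (L.symm : ℂ →L[ℝ] ℂ)
    have hfun : (U ∘ ⇑L) ∘ ⇑(L.symm : ℂ →L[ℝ] ℂ) = U := by
      funext w
      simp
    rwa [hfun] at h'

/-- Boundary conditions near an arc transfer along the linear change of variables `V = U ∘ L`
(`O ↦ L ⁻¹' O`, `O ↦ L '' O`).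
[cite: AhlforsBers1960, Thm. 11 (analytic dependence of the modulus; here via the Dirichlet principle — bookkeeping)] -/
private theorem bc_comp_iff (L : ℂ ≃L[ℝ] ℂ) {S A : Set ℂ} {U : ℂ → ℝ} {c : ℝ} :
    (∃ O : Set ℂ, IsOpen O ∧ L '' A ⊆ O ∧ ∀ z ∈ O ∩ L '' S, U z = c) ↔
      ∃ O : Set ℂ, IsOpen O ∧ A ⊆ O ∧ ∀ z ∈ O ∩ S, (U ∘ L) z = c := by
  constructor
  · rintro ⟨O, hO, hAO, hU⟩
    exact ⟨L ⁻¹' O, hO.preimage L.continuous, image_subset_iff.1 hAO,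
      fun z hz => hU (L z) ⟨hz.1, mem_image_of_mem L hz.2⟩⟩
  · rintro ⟨O, hO, hAO, hU⟩
    refine ⟨L '' O, L.isOpenMap O hO, image_mono hAO, ?_⟩
    rintro w ⟨⟨o, ho, rfl⟩, ⟨z, hz, hzo⟩⟩
    obtain rfl := L.injective hzo
    exact hU z ⟨ho, hz⟩

/-- **Stub `SH` of line `Sketch`.** The set of Dirichlet energies of the admissible test
functions of the sheared quad `φ_α R'` (`φ_α = moduliShear α`, `im α > 0`) equals the set of
`α`-anisotropic energies `∫_{R'} im α (∂ₓV)² + (∂_yV − re α ∂ₓV)² / im α` of the admissible test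
functions `V` of `R'`: the linear change of variables `V = U ∘ φ_α` (Jacobian `im α`,
`∇U (φ_α z) = (∂ₓV z, (∂_yV z − re α ∂ₓV z) / im α)`), transporting `C¹`-regularity,
square-integrability of the gradient and the boundary conditions near the arcs both ways.
[cite: AhlforsBers1960, Thm. 11 (analytic dependence of the modulus; here via the Dirichlet principle — bookkeeping)] -/
theorem stub_shearCapacity_eq :
    ∀ (R' : ConformalRectangle) (α : ℂ) (hα : 0 < α.im),
      {e : ℝ | ∃ U : ℂ → ℝ,
          (ContDiffOn ℝ 1 U (R'.map (shearHomeomorph α hα.ne')).carrier ∧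
            IntegrableOn (fun z => ‖fderiv ℝ U z‖ ^ 2) (R'.map (shearHomeomorph α hα.ne')).carrier ∧
            (∃ O : Set ℂ, IsOpen O ∧ (R'.map (shearHomeomorph α hα.ne')).arc 0 ⊆ O ∧
              ∀ z ∈ O ∩ (R'.map (shearHomeomorph α hα.ne')).carrier, U z = 0) ∧
            (∃ O : Set ℂ, IsOpen O ∧ (R'.map (shearHomeomorph α hα.ne')).arc 2 ⊆ O ∧
              ∀ z ∈ O ∩ (R'.map (shearHomeomorph α hα.ne')).carrier, U z = 1)) ∧
          e = ∫ z in (R'.map (shearHomeomorph α hα.ne')).carrier, ‖fderiv ℝ U z‖ ^ 2} =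
      {e : ℝ | ∃ U : ℂ → ℝ,
          (ContDiffOn ℝ 1 U R'.carrier ∧
            IntegrableOn (fun z => ‖fderiv ℝ U z‖ ^ 2) R'.carrier ∧
            (∃ O : Set ℂ, IsOpen O ∧ R'.arc 0 ⊆ O ∧ ∀ z ∈ O ∩ R'.carrier, U z = 0) ∧
            (∃ O : Set ℂ, IsOpen O ∧ R'.arc 2 ⊆ O ∧ ∀ z ∈ O ∩ R'.carrier, U z = 1)) ∧
          e = ∫ z in R'.carrier, (α.im * (fderiv ℝ U z 1) ^ 2 +
            (fderiv ℝ U z Complex.I - α.re * fderiv ℝ U z 1) ^ 2 / α.im)} := by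
  intro R' α hα
  obtain ⟨L, hL, hdet⟩ := exists_shearCLE α hα.ne'
  simp only [MarkedDomain.carrier_map, MarkedDomain.arc_map, coe_shearHomeomorph]
  rw [← hL]
  ext e
  constructor
  · rintro ⟨U, ⟨hC, hI, h0, h2⟩, rfl⟩
    exact ⟨U ∘ L, ⟨(contDiffOn_comp_iff L).1 hC, (integrableOn_comp_iff hα L hdet R'.isOpen hC).1 hI,
      (bc_comp_iff L).1 h0, (bc_comp_iff L).1 h2⟩, energy_eq hα L hL hdet R'.isOpen hC⟩
  · rintro ⟨V, ⟨hC, hI, h0, h2⟩, rfl⟩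
    have hUV : (V ∘ ⇑L.symm) ∘ ⇑L = V := by
      funext z
      simp
    have hC' : ContDiffOn ℝ 1 (V ∘ ⇑L.symm) (L '' R'.carrier) := by
      rw [contDiffOn_comp_iff L, hUV]
      exact hC
    refine ⟨V ∘ L.symm, ⟨hC', ?_, ?_, ?_⟩, ?_⟩
    · rw [integrableOn_comp_iff hα L hdet R'.isOpen hC', hUV]
      exact hI
    · rw [bc_comp_iff L, hUV]
      exact h0
    · rw [bc_comp_iff L, hUV]
      exact h2
    · rw [energy_eq hα L hL hdet R'.isOpen hC', hUV]

end Literature.Probability.RandomPlanarGeometry.ShearModulus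

end Part2

/-!
## Part 3 — port of `Summits/CriticalPhenomena/CardyFormulaZ2/Theorems/CardySelfDualSegmentSegmentOpenStubRectCapacity.lean` (14 declarations kept)

# Crux `SegmentOpen` , line `Sketch` — stub `stub_rectCapacity`

The model computation of the Dirichlet principle on `R = (0,w) × (0,h)`: the infimum of the
energies `∫_R ‖∇U‖²` over admissible `U` (C¹ on `R`, finite energy, `0` near the bottom side, `1`
near the top side) is `w / h` (Ahlfors, *Conformal Invariants* (1973), §4-2). Lower bound: on
each vertical slice FTC and Cauchy–Schwarz (as `∫ (g' - c)² ≥ 0`) give `∫₀ʰ |∂_y U|² ≥ 1/h`, then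
Tonelli over `x`. Upper bound: `U z = P (im z) / P h`, `P` the primitive of a continuous
trapezoid (`0` near `0` and `h`, `1` in the bulk), of energy `≤ w / (h - 4δ) → w / h`.

(Verbatim declaration-level port — the declarations listed in the Part header count — of the Summits-side module of the CardyFormulaZ2
tree; route / stub bookkeeping in the text above is historical.)
-/

section Part3

namespace Literature.Probability.RandomPlanarGeometry.ShearModulus

open Literature.Probability Literature.Barriers.CriticalPhenomena
open Literature.Probability.RandomPlanarGeometry (ConformalRectangle ConformalEquiv MarkedDomain)
open _root_.Filter _root_.Set _root_.Topology _root_.MeasureTheory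
open _root_.UpperHalfPlane (upperHalfPlaneSet)
open scoped _root_.ENNReal
open _root_.Complex (I measurableEquivRealProd volume_preserving_equiv_real_prod)

namespace RectCapacity

/-- The rectangle read in `ℝ × ℝ`.
[cite: AhlforsBers1960, Thm. 11 (analytic dependence of the modulus; here via the Dirichlet principle — bookkeeping)] -/
theorem preimage_rect (a b : ℝ) :
    measurableEquivRealProd.symm ⁻¹' (Ioo 0 a ×ℂ Ioo 0 b) = Ioo 0 a ×ˢ Ioo 0 b := by
  ext p
  simp [Complex.mem_reProdIm]

/-- Tonelli on `(0,a) × (0,b) ⊆ ℂ` with the vertical slices inside: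
`∬ ρ = ∫₀ᵃ (∫₀ᵇ ρ (x + iy) dy) dx` for Borel `ρ`.
[cite: AhlforsBers1960, Thm. 11 (analytic dependence of the modulus; here via the Dirichlet principle — bookkeeping)] -/
theorem lintegral_rect_eq {ρ : ℂ → ℝ≥0∞} (hρ : Measurable ρ) (a b : ℝ) :
    ∫⁻ z in Ioo 0 a ×ℂ Ioo 0 b, ρ z = ∫⁻ x in Ioo 0 a, ∫⁻ y in Ioo 0 b, ρ ⟨x, y⟩ := by
  have hF : Measurable fun p : ℝ × ℝ => ρ (measurableEquivRealProd.symm p) :=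
    hρ.comp measurableEquivRealProd.symm.measurable
  rw [← (volume_preserving_equiv_real_prod.symm
      measurableEquivRealProd).setLIntegral_comp_preimage_emb
    measurableEquivRealProd.symm.measurableEmbedding ρ, preimage_rect, Measure.volume_eq_prod,
    ← Measure.prod_restrict, lintegral_prod _ hF.aemeasurable]
  rfl

/-- Fubini for a function of the height only: `∬_{(0,a)×(0,b)} G (im z) = a ∫₀ᵇ G`.
[cite: AhlforsBers1960, Thm. 11 (analytic dependence of the modulus; here via the Dirichlet principle — bookkeeping)] -/
theorem setIntegral_rect_im (G : ℝ → ℝ) {a : ℝ} (ha : 0 ≤ a) (b : ℝ) :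
    ∫ z in Ioo 0 a ×ℂ Ioo 0 b, G z.im = a * ∫ y in Ioo 0 b, G y := by
  rw [← (volume_preserving_equiv_real_prod.symm measurableEquivRealProd).setIntegral_preimage_emb
    measurableEquivRealProd.symm.measurableEmbedding (fun z => G z.im), preimage_rect,
    Measure.volume_eq_prod, ← Measure.prod_restrict]
  simp only [Complex.measurableEquivRealProd_symm_apply]
  rw [integral_fun_snd, measureReal_restrict_apply_univ, Real.volume_real_Ioo, sub_zero,
    max_eq_left ha, smul_eq_mul]

/-- Tube lemma: an open set containing the horizontal side `[0,w] × {y₀}` contains a band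
`[0,w] × (y₀ - ε, y₀ + ε)`.
[cite: AhlforsBers1960, Thm. 11 (analytic dependence of the modulus; here via the Dirichlet principle — bookkeeping)] -/
theorem exists_band_subset {O : Set ℂ} (hO : IsOpen O) {w y₀ : ℝ}
    (hsub : ∀ z : ℂ, z.im = y₀ → z.re ∈ Icc 0 w → z ∈ O) :
    ∃ ε > 0, ∀ z : ℂ, z.re ∈ Icc 0 w → |z.im - y₀| < ε → z ∈ O := by
  have hK : IsCompact (Icc 0 w ×ℂ {y₀}) := isCompact_Icc.reProdIm isCompact_singleton
  have hKO : Icc 0 w ×ℂ {y₀} ⊆ O := fun z hz =>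
    hsub z (mem_singleton_iff.1 (Complex.mem_reProdIm.1 hz).2) (Complex.mem_reProdIm.1 hz).1
  obtain ⟨ε, hε, hεO⟩ := hK.exists_thickening_subset_open hO hKO
  refine ⟨ε, hε, fun z hre him => hεO (Metric.mem_thickening_iff.2 ⟨⟨z.re, y₀⟩, ?_, ?_⟩)⟩
  · exact Complex.mem_reProdIm.2 ⟨hre, rfl⟩
  · rw [Complex.dist_of_re_eq (z := z) (w := ⟨z.re, y₀⟩) rfl, Real.dist_eq]
    exact him

/-- The one-dimensional estimate: if `g a = 0`, `g b = 1` and `g` is C¹ on `[a,b]`, then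
`1/(b-a) ≤ ∫ₐᵇ g'²` (expand `0 ≤ ∫ₐᵇ (g' - 1/(b-a))²` and use `∫ₐᵇ g' = 1`).
[cite: AhlforsBers1960, Thm. 11 (analytic dependence of the modulus; here via the Dirichlet principle — bookkeeping)] -/
theorem one_div_le_integral_sq {g g' : ℝ → ℝ} {a b : ℝ} (hab : a < b)
    (hderiv : ∀ y ∈ Icc a b, HasDerivAt g (g' y) y) (hcont : ContinuousOn g' (Icc a b))
    (hga : g a = 0) (hgb : g b = 1) : 1 / (b - a) ≤ ∫ y in a..b, g' y ^ 2 := by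
  have hI : uIcc a b = Icc a b := uIcc_of_le hab.le
  have hc1 : ContinuousOn g' (uIcc a b) := by rwa [hI]
  have hi1 : IntervalIntegrable g' volume a b := hc1.intervalIntegrable
  have hi2 : IntervalIntegrable (fun y => g' y ^ 2) volume a b := (hc1.pow 2).intervalIntegrable
  have hftc : ∫ y in a..b, g' y = 1 := by
    rw [intervalIntegral.integral_eq_sub_of_hasDerivAt (fun y hy => hderiv y (hI ▸ hy)) hi1, hga,
      hgb, sub_zero]
  set c := 1 / (b - a) with hc
  have hba : 0 < b - a := sub_pos.2 hab
  have hcc : c ^ 2 * (b - a) = c := by rw [hc]; field_simp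
  have hnonneg : 0 ≤ ∫ y in a..b, (g' y - c) ^ 2 :=
    intervalIntegral.integral_nonneg hab.le fun y _ => sq_nonneg _
  have hexp : ∫ y in a..b, (g' y - c) ^ 2 =
      (∫ y in a..b, g' y ^ 2) - 2 * c * (∫ y in a..b, g' y) + c ^ 2 * (b - a) := by
    have e : ∀ y, (g' y - c) ^ 2 = (g' y ^ 2 - (2 * c) * g' y) + c ^ 2 := fun y => by ring
    simp_rw [e]
    rw [intervalIntegral.integral_add (hi2.sub (hi1.const_mul _)) intervalIntegrable_const,
      intervalIntegral.integral_sub hi2 (hi1.const_mul _), intervalIntegral.integral_const_mul,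
      intervalIntegral.integral_const, smul_eq_mul]
    ring
  rw [hftc, hcc] at hexp
  linarith

/-- **Slice bound.** If `U` is C¹ on the open rectangle, vanishes on the part of the rectangle
at height `< ε₀` and equals `1` on the part at height `> h - ε₁`, then along every vertical slice
`∫₀ʰ ‖∇U (x + iy)‖² dy ≥ 1/h`.
[cite: AhlforsBers1960, Thm. 11 (analytic dependence of the modulus; here via the Dirichlet principle — bookkeeping)] -/
theorem slice_bound {U : ℂ → ℝ} {w h x ε₀ ε₁ : ℝ} (hh : 0 < h)
    (hU : ContDiffOn ℝ 1 U (Ioo 0 w ×ℂ Ioo 0 h))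
    (hε₀ : 0 < ε₀) (h0 : ∀ z ∈ Ioo 0 w ×ℂ Ioo 0 h, |z.im| < ε₀ → U z = 0)
    (hε₁ : 0 < ε₁) (h1 : ∀ z ∈ Ioo 0 w ×ℂ Ioo 0 h, |z.im - h| < ε₁ → U z = 1)
    (hx : x ∈ Ioo 0 w) :
    ENNReal.ofReal (1 / h) ≤ ∫⁻ y in Ioo 0 h, ENNReal.ofReal (‖fderiv ℝ U ⟨x, y⟩‖ ^ 2) := by
  have hRo : IsOpen (Ioo 0 w ×ℂ Ioo 0 h) := isOpen_Ioo.reProdIm isOpen_Ioo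
  obtain ⟨ε, hε, hεle₀, hεle₁, hεh⟩ : ∃ ε, 0 < ε ∧ ε ≤ ε₀ ∧ ε ≤ ε₁ ∧ ε ≤ h :=
    ⟨min (min ε₀ ε₁) h, lt_min (lt_min hε₀ hε₁) hh, (min_le_left _ _).trans (min_le_left _ _),
      (min_le_left _ _).trans (min_le_right _ _), min_le_right _ _⟩
  set a := ε / 4 with ha
  set b := h - ε / 4 with hb
  have ha0 : 0 < a := by positivity
  have hab : a < b := by rw [ha, hb]; linarith
  have hbh : b < h := by rw [hb]; linarith
  have hIcc : Icc a b ⊆ Ioo 0 h := fun y hy => ⟨ha0.trans_le hy.1, hy.2.trans_lt hbh⟩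
  -- the vertical slice through `x`
  have hmk : (fun y : ℝ => (⟨x, y⟩ : ℂ)) = fun y : ℝ => (x : ℂ) + ((y : ℝ) : ℂ) * I :=
    funext fun y => Complex.mk_eq_add_mul_I x y
  have hγ : ∀ y : ℝ, HasDerivAt (fun y : ℝ => (⟨x, y⟩ : ℂ)) I y := fun y => by
    rw [hmk]
    simpa using ((hasDerivAt_id y).ofReal_comp.mul_const I).const_add (x : ℂ)
  have hγc : Continuous fun y : ℝ => (⟨x, y⟩ : ℂ) := by rw [hmk]; fun_prop
  have hγR : ∀ y ∈ Ioo 0 h, (⟨x, y⟩ : ℂ) ∈ Ioo 0 w ×ℂ Ioo 0 h := fun y hy =>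
    Complex.mem_reProdIm.2 ⟨hx, hy⟩
  set g' : ℝ → ℝ := fun y => fderiv ℝ U ⟨x, y⟩ I with hg'
  have hderiv : ∀ y ∈ Icc a b, HasDerivAt (fun y : ℝ => U ⟨x, y⟩) (g' y) y := fun y hy =>
    ((hU.differentiableOn one_ne_zero).differentiableAt
      (hRo.mem_nhds (hγR y (hIcc hy)))).hasFDerivAt.comp_hasDerivAt y (hγ y)
  have hcont : ContinuousOn g' (Icc a b) :=
    ((hU.continuousOn_fderiv_of_isOpen hRo le_rfl).comp hγc.continuousOn
      fun y hy => hγR y (hIcc hy)).clm_apply continuousOn_const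
  have hga : U ⟨x, a⟩ = 0 :=
    h0 _ (hγR a ⟨ha0, hab.trans hbh⟩) (by show |a| < ε₀; rw [abs_of_pos ha0, ha]; linarith)
  have hgb : U ⟨x, b⟩ = 1 := h1 _ (hγR b ⟨ha0.trans hab, hbh⟩) (by
    show |b - h| < ε₁
    rw [show b - h = -(ε / 4) by rw [hb]; ring, abs_neg, abs_of_pos (by positivity)]
    linarith)
  have hle : ∀ y, g' y ^ 2 ≤ ‖fderiv ℝ U ⟨x, y⟩‖ ^ 2 := fun y => by
    rw [← sq_abs]
    refine pow_le_pow_left₀ (abs_nonneg _) ?_ 2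
    simpa [Real.norm_eq_abs] using (fderiv ℝ U ⟨x, y⟩).le_opNorm I
  have hint2 : IntegrableOn (fun y => g' y ^ 2) (Ioc a b) :=
    ((hcont.pow 2).integrableOn_Icc).mono_set Ioc_subset_Icc_self
  calc ENNReal.ofReal (1 / h) ≤ ENNReal.ofReal (1 / (b - a)) :=
        ENNReal.ofReal_le_ofReal
          (one_div_le_one_div_of_le (sub_pos.2 hab) (by rw [hb, ha]; linarith))
    _ ≤ ENNReal.ofReal (∫ y in a..b, g' y ^ 2) :=
        ENNReal.ofReal_le_ofReal (one_div_le_integral_sq hab hderiv hcont hga hgb)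
    _ = ∫⁻ y in Ioc a b, ENNReal.ofReal (g' y ^ 2) := by
        rw [intervalIntegral.integral_of_le hab.le,
          ofReal_integral_eq_lintegral_ofReal hint2 (Eventually.of_forall fun y => sq_nonneg _)]
    _ ≤ ∫⁻ y in Ioc a b, ENNReal.ofReal (‖fderiv ℝ U ⟨x, y⟩‖ ^ 2) :=
        lintegral_mono fun y => ENNReal.ofReal_le_ofReal (hle y)
    _ ≤ ∫⁻ y in Ioo 0 h, ENNReal.ofReal (‖fderiv ℝ U ⟨x, y⟩‖ ^ 2) :=
        lintegral_mono_set fun y hy => ⟨ha0.trans hy.1, hy.2.trans_lt hbh⟩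

/-- **Lower bound.** Every admissible test function on `(0,w) × (0,h)` has Dirichlet energy
`≥ w / h`.
[cite: AhlforsBers1960, Thm. 11 (analytic dependence of the modulus; here via the Dirichlet principle — bookkeeping)] -/
theorem lower_bound {U : ℂ → ℝ} {w h ε₀ ε₁ : ℝ} (hh : 0 < h)
    (hU : ContDiffOn ℝ 1 U (Ioo 0 w ×ℂ Ioo 0 h))
    (hint : IntegrableOn (fun z => ‖fderiv ℝ U z‖ ^ 2) (Ioo 0 w ×ℂ Ioo 0 h))
    (hε₀ : 0 < ε₀) (h0 : ∀ z ∈ Ioo 0 w ×ℂ Ioo 0 h, |z.im| < ε₀ → U z = 0)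
    (hε₁ : 0 < ε₁) (h1 : ∀ z ∈ Ioo 0 w ×ℂ Ioo 0 h, |z.im - h| < ε₁ → U z = 1) :
    w / h ≤ ∫ z in Ioo 0 w ×ℂ Ioo 0 h, ‖fderiv ℝ U z‖ ^ 2 := by
  have hmeas : Measurable fun z => ‖fderiv ℝ U z‖ ^ 2 :=
    (measurable_fderiv ℝ U).norm.pow_const 2
  have hnn : 0 ≤ᵐ[volume.restrict (Ioo 0 w ×ℂ Ioo 0 h)] fun z => ‖fderiv ℝ U z‖ ^ 2 :=
    Eventually.of_forall fun z => sq_nonneg _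
  rw [integral_eq_lintegral_of_nonneg_ae hnn hmeas.aestronglyMeasurable]
  have hfin : ∫⁻ z in Ioo 0 w ×ℂ Ioo 0 h, ENNReal.ofReal (‖fderiv ℝ U z‖ ^ 2) ≠ ∞ :=
    ((hasFiniteIntegral_iff_ofReal hnn).1 hint.hasFiniteIntegral).ne
  refine (ENNReal.ofReal_le_iff_le_toReal hfin).1 ?_
  rw [lintegral_rect_eq hmeas.ennreal_ofReal]
  calc ENNReal.ofReal (w / h) = ENNReal.ofReal (1 / h) * volume (Ioo (0 : ℝ) w) := by
        rw [Real.volume_Ioo, sub_zero, ← ENNReal.ofReal_mul (by positivity), one_div_mul_eq_div]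
    _ = ∫⁻ _ in Ioo (0 : ℝ) w, ENNReal.ofReal (1 / h) := (setLIntegral_const _ _).symm
    _ ≤ ∫⁻ x in Ioo 0 w, ∫⁻ y in Ioo 0 h, ENNReal.ofReal (‖fderiv ℝ U ⟨x, y⟩‖ ^ 2) :=
        setLIntegral_mono' measurableSet_Ioo fun x hx => slice_bound hh hU hε₀ h0 hε₁ h1 hx

/-- The trapezoid `k_δ(t) = max 0 (min 1 (min (t/δ - 1) ((h - t)/δ - 1)))` vanishes below `δ`
and above `h - δ`.
[cite: AhlforsBers1960, Thm. 11 (analytic dependence of the modulus; here via the Dirichlet principle — bookkeeping)] -/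
theorem trap_eq_zero {δ h t : ℝ} (hδ : 0 < δ) (ht : t ≤ δ ∨ h - δ ≤ t) :
    max 0 (min 1 (min (t / δ - 1) ((h - t) / δ - 1))) = 0 := by
  refine max_eq_left ((min_le_right _ _).trans ?_)
  rcases ht with ht | ht
  · exact (min_le_left _ _).trans (by rw [sub_nonpos, div_le_one hδ]; exact ht)
  · exact (min_le_right _ _).trans (by rw [sub_nonpos, div_le_one hδ]; linarith)

/-- The trapezoid `k_δ` equals `1` on `[2δ, h - 2δ]`.
[cite: AhlforsBers1960, Thm. 11 (analytic dependence of the modulus; here via the Dirichlet principle — bookkeeping)] -/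
theorem trap_eq_one {δ h t : ℝ} (hδ : 0 < δ) (ht : t ∈ Icc (2 * δ) (h - 2 * δ)) :
    max 0 (min 1 (min (t / δ - 1) ((h - t) / δ - 1))) = 1 := by
  have h1 : 1 ≤ t / δ - 1 := by rw [le_sub_iff_add_le, le_div_iff₀ hδ]; linarith [ht.1]
  have h2 : 1 ≤ (h - t) / δ - 1 := by rw [le_sub_iff_add_le, le_div_iff₀ hδ]; linarith [ht.2]
  rw [min_eq_left (le_min h1 h2), max_eq_right zero_le_one]

/-- **The energy of a height profile.** For continuous `k` and `U z = (∫₀^{im z} k) / K`: `U` is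
C¹ with `‖dU(z)‖² = (k (im z) / K)²`, and its energy on `(0,w) × (0,h)` is `w ∫₀ʰ k² / K²`.
[cite: AhlforsBers1960, Thm. 11 (analytic dependence of the modulus; here via the Dirichlet principle — bookkeeping)] -/
theorem profile_energy {k : ℝ → ℝ} (hkc : Continuous k) (K : ℝ) {w h : ℝ} (hw : 0 ≤ w)
    (hh : 0 ≤ h) :
    ContDiff ℝ 1 (fun z : ℂ => (∫ t in (0 : ℝ)..z.im, k t) / K) ∧
    IntegrableOn (fun z => ‖fderiv ℝ (fun z : ℂ => (∫ t in (0 : ℝ)..z.im, k t) / K) z‖ ^ 2)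
      (Ioo 0 w ×ℂ Ioo 0 h) ∧
    ∫ z in Ioo 0 w ×ℂ Ioo 0 h, ‖fderiv ℝ (fun z : ℂ => (∫ t in (0 : ℝ)..z.im, k t) / K) z‖ ^ 2 =
      w * ((∫ t in (0 : ℝ)..h, k t ^ 2) / K ^ 2) := by
  have hPd : ∀ y, HasDerivAt (fun y => (∫ t in (0 : ℝ)..y, k t) / K) (k y / K) y := fun y =>
    (hkc.integral_hasStrictDerivAt 0 y).hasDerivAt.div_const K
  have hU : ∀ z : ℂ, HasFDerivAt (fun z : ℂ => (∫ t in (0 : ℝ)..z.im, k t) / K)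
      ((k z.im / K) • Complex.imCLM) z := fun z =>
    (hPd z.im).comp_hasFDerivAt z Complex.imCLM.hasFDerivAt
  have hnorm : ∀ z : ℂ, ‖fderiv ℝ (fun z : ℂ => (∫ t in (0 : ℝ)..z.im, k t) / K) z‖ ^ 2 =
      (k z.im / K) ^ 2 := fun z => by
    rw [(hU z).fderiv, norm_smul, Complex.imCLM_norm, mul_one, Real.norm_eq_abs, sq_abs]
  refine ⟨?_, ?_, ?_⟩
  · have hg : ContDiff ℝ 1 (fun y => (∫ t in (0 : ℝ)..y, k t) / K) := by
      rw [contDiff_one_iff_deriv]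
      refine ⟨fun y => (hPd y).differentiableAt, ?_⟩
      rw [show deriv (fun y => (∫ t in (0 : ℝ)..y, k t) / K) = fun y => k y / K from
        funext fun y => (hPd y).deriv]
      exact hkc.div_const _
    exact hg.comp Complex.imCLM.contDiff
  · simp only [hnorm]
    have hc : Continuous fun z : ℂ => (k z.im / K) ^ 2 :=
      ((hkc.comp Complex.continuous_im).div_const _).pow 2
    exact (hc.continuousOn.integrableOn_compact (isCompact_Icc.reProdIm isCompact_Icc)).mono_set
      fun z hz => ⟨Ioo_subset_Icc_self hz.1, Ioo_subset_Icc_self hz.2⟩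
  · simp only [hnorm]
    rw [setIntegral_rect_im (fun y => (k y / K) ^ 2) hw h, ← integral_Ioc_eq_integral_Ioo,
      ← intervalIntegral.integral_of_le hh]
    simp_rw [div_pow]
    rw [intervalIntegral.integral_div]

/-- **Upper bound.** For `0 < 4δ < h`: a C¹ function on `ℂ`, `0` at height `≤ δ`, `1` at height
`≥ h - δ`, of energy `≤ w / (h - 4δ)` on `(0,w) × (0,h)` — the normalised primitive
`U z = (∫₀^{im z} k_δ) / ∫₀ʰ k_δ` of the trapezoid (`∫ k_δ² ≤ ∫ k_δ`, `∫₀ʰ k_δ ≥ h - 4δ`).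
[cite: AhlforsBers1960, Thm. 11 (analytic dependence of the modulus; here via the Dirichlet principle — bookkeeping)] -/
theorem exists_testFn {δ w h : ℝ} (hδ : 0 < δ) (h4 : 4 * δ < h) (hw : 0 < w) :
    ∃ U : ℂ → ℝ, ContDiff ℝ 1 U ∧
      IntegrableOn (fun z => ‖fderiv ℝ U z‖ ^ 2) (Ioo 0 w ×ℂ Ioo 0 h) ∧
      (∀ z : ℂ, z.im ≤ δ → U z = 0) ∧ (∀ z : ℂ, h - δ ≤ z.im → U z = 1) ∧
      ∫ z in Ioo 0 w ×ℂ Ioo 0 h, ‖fderiv ℝ U z‖ ^ 2 ≤ w / (h - 4 * δ) := by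
  obtain ⟨k, hk0, hk1, hkc, hkz, hko⟩ : ∃ k : ℝ → ℝ, (∀ t, 0 ≤ k t) ∧ (∀ t, k t ≤ 1) ∧
      Continuous k ∧ (∀ t, t ≤ δ ∨ h - δ ≤ t → k t = 0) ∧
      ∀ t ∈ Icc (2 * δ) (h - 2 * δ), k t = 1 :=
    ⟨fun t => max 0 (min 1 (min (t / δ - 1) ((h - t) / δ - 1))), fun t => le_max_left _ _,
      fun t => max_le zero_le_one (min_le_left _ _), by fun_prop, fun t ht => trap_eq_zero hδ ht,
      fun t ht => trap_eq_one hδ ht⟩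
  have hi : ∀ a b : ℝ, IntervalIntegrable k volume a b := fun a b => hkc.intervalIntegrable a b
  set K := ∫ t in (0 : ℝ)..h, k t with hK
  have hKle : h - 4 * δ ≤ K := by
    rw [hK, ← intervalIntegral.integral_add_adjacent_intervals (hi 0 (2 * δ)) (hi (2 * δ) h),
      ← intervalIntegral.integral_add_adjacent_intervals (hi (2 * δ) (h - 2 * δ))
        (hi (h - 2 * δ) h)]
    have h1 : 0 ≤ ∫ t in (0 : ℝ)..(2 * δ), k t :=
      intervalIntegral.integral_nonneg (by linarith) fun t _ => hk0 t
    have h3 : 0 ≤ ∫ t in (h - 2 * δ)..h, k t :=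
      intervalIntegral.integral_nonneg (by linarith) fun t _ => hk0 t
    have h2 : ∫ t in (2 * δ)..(h - 2 * δ), k t = h - 4 * δ := by
      rw [intervalIntegral.integral_congr (g := fun _ => (1 : ℝ)) fun t ht => ?_,
        intervalIntegral.integral_const, smul_eq_mul, mul_one]
      · ring
      · rw [uIcc_of_le (by linarith)] at ht
        exact hko t ht
    linarith
  have hK0 : 0 < K := by linarith
  obtain ⟨hcd, hint, hen⟩ := profile_energy hkc K hw.le (by linarith : (0 : ℝ) ≤ h)
  refine ⟨fun z => (∫ t in (0 : ℝ)..z.im, k t) / K, hcd, hint, fun z hz => ?_, fun z hz => ?_, ?_⟩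
  · show (∫ t in (0 : ℝ)..z.im, k t) / K = 0
    rw [intervalIntegral.integral_congr (g := fun _ => (0 : ℝ)) fun t ht => ?_,
      intervalIntegral.integral_zero, zero_div]
    exact hkz t (Or.inl (ht.2.trans (max_le hδ.le hz)))
  · show (∫ t in (0 : ℝ)..z.im, k t) / K = 1
    rw [div_eq_one_iff_eq hK0.ne', hK,
      ← intervalIntegral.integral_add_adjacent_intervals (hi 0 h) (hi h z.im),
      intervalIntegral.integral_congr (g := fun _ => (0 : ℝ)) (a := h) fun t ht => ?_,
      intervalIntegral.integral_zero, add_zero]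
    exact hkz t (Or.inr (le_trans (le_min (by linarith) hz) ht.1))
  · rw [hen]
    have h2 : ∫ t in (0 : ℝ)..h, k t ^ 2 ≤ K :=
      intervalIntegral.integral_mono_on (by linarith) ((hkc.pow 2).intervalIntegrable 0 h)
        (hi 0 h) fun t _ => pow_le_of_le_one (hk0 t) (hk1 t) two_ne_zero
    calc w * ((∫ t in (0 : ℝ)..h, k t ^ 2) / K ^ 2) ≤ w * (K / K ^ 2) :=
          mul_le_mul_of_nonneg_left (div_le_div_of_nonneg_right h2 (sq_nonneg _)) hw.le
      _ = w / K := by field_simp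
      _ ≤ w / (h - 4 * δ) := div_le_div_of_nonneg_left hw.le (by linarith) hKle

/-- Choice of the parameter: `w / (h - 4δ) → w / h` as `δ → 0⁺`.
[cite: AhlforsBers1960, Thm. 11 (analytic dependence of the modulus; here via the Dirichlet principle — bookkeeping)] -/
theorem exists_delta {w h ε : ℝ} (hh : 0 < h) (hε : 0 < ε) :
    ∃ δ : ℝ, 0 < δ ∧ 4 * δ < h ∧ w / (h - 4 * δ) < w / h + ε := by
  have hca : ContinuousAt (fun δ : ℝ => w / (h - 4 * δ)) 0 := by
    fun_prop (disch := simpa using hh.ne')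
  have hlim : Tendsto (fun δ : ℝ => w / (h - 4 * δ)) (𝓝 0) (𝓝 (w / h)) := by
    simpa using hca.tendsto
  have e1 : ∀ᶠ δ in 𝓝[>] (0 : ℝ), 0 < δ := eventually_mem_nhdsWithin
  have e2 : ∀ᶠ δ in 𝓝 (0 : ℝ), δ < h / 4 := Iio_mem_nhds (by positivity)
  have e3 : ∀ᶠ δ in 𝓝 (0 : ℝ), w / (h - 4 * δ) < w / h + ε :=
    hlim.eventually_lt_const (by linarith)
  obtain ⟨δ, hδ, h4, hlt⟩ := (e1.and ((e2.and e3).filter_mono nhdsWithin_le_nhds)).exists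
  exact ⟨δ, hδ, by linarith, hlt⟩

/-- Infimum characterisation used to assemble the two bounds.
[cite: AhlforsBers1960, Thm. 11 (analytic dependence of the modulus; here via the Dirichlet principle — bookkeeping)] -/
theorem sInf_eq_of_forall {S : Set ℝ} {m : ℝ} (hlow : ∀ e ∈ S, m ≤ e)
    (hup : ∀ ε > 0, ∃ e ∈ S, e < m + ε) : sInf S = m := by
  have hne : S.Nonempty := let ⟨e, he, _⟩ := hup 1 one_pos; ⟨e, he⟩
  refine le_antisymm (le_of_forall_pos_lt_add fun ε hε => ?_) (le_csInf hne hlow)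
  obtain ⟨e, he, hlt⟩ := hup ε hε
  exact (csInf_le ⟨m, hlow⟩ he).trans_lt hlt

end RectCapacity

open RectCapacity in
/-- **The minimal admissible Dirichlet energy of the rectangle `(0,w) × (0,h)` is `w / h`**
(Ahlfors, *Conformal Invariants* (1973), §4-2: extremal length / capacity of a rectangle), the
admissible test functions being C¹ on the open rectangle with finite energy, `0` near the bottom
side (arc `0`) and `1` near the top side (arc `2`). Lower bound: slice-wise Cauchy–Schwarz and
Tonelli; upper bound: normalised primitives of trapezoids.
[cite: AhlforsBers1960, Thm. 11 (analytic dependence of the modulus; here via the Dirichlet principle — bookkeeping)] -/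
theorem stub_rectCapacity :
    ∀ (w h : ℝ) (hw : 0 < w) (hh : 0 < h),
      sInf {e : ℝ | ∃ U : ℂ → ℝ,
          (ContDiffOn ℝ 1 U (Percolation.rectQuad 0 w 0 h hw hh).carrier ∧
            IntegrableOn (fun z => ‖fderiv ℝ U z‖ ^ 2) (Percolation.rectQuad 0 w 0 h hw hh).carrier ∧
            (∃ O : Set ℂ, IsOpen O ∧ (Percolation.rectQuad 0 w 0 h hw hh).arc 0 ⊆ O ∧
              ∀ z ∈ O ∩ (Percolation.rectQuad 0 w 0 h hw hh).carrier, U z = 0) ∧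
            (∃ O : Set ℂ, IsOpen O ∧ (Percolation.rectQuad 0 w 0 h hw hh).arc 2 ⊆ O ∧
              ∀ z ∈ O ∩ (Percolation.rectQuad 0 w 0 h hw hh).carrier, U z = 1)) ∧
          e = ∫ z in (Percolation.rectQuad 0 w 0 h hw hh).carrier, ‖fderiv ℝ U z‖ ^ 2} =
        w / h := by
  intro w h hw hh
  have hcar : (Percolation.rectQuad 0 w 0 h hw hh).carrier = Ioo 0 w ×ℂ Ioo 0 h :=
    Percolation.rectQuad_carrier hw hh
  refine sInf_eq_of_forall ?_ fun ε hε => ?_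
  · -- lower bound
    rintro e ⟨U, ⟨hU, hint, ⟨O, hO, hO0, hU0⟩, ⟨O', hO', hO2, hU1⟩⟩, rfl⟩
    rw [hcar] at hU hint hU0 hU1 ⊢
    obtain ⟨ε₀, hε₀, h0⟩ := exists_band_subset hO (y₀ := 0) (w := w)
      fun z hz1 hz2 => hO0 ((Percolation.mem_rectQuad_arc_zero hw hh).2 ⟨hz1, hz2⟩)
    obtain ⟨ε₁, hε₁, h1⟩ := exists_band_subset hO' (y₀ := h) (w := w)
      fun z hz1 hz2 => hO2 ((Percolation.mem_rectQuad_arc_two hw hh).2 ⟨hz1, hz2⟩)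
    refine lower_bound hh hU hint hε₀ (fun z hz him => hU0 z ⟨h0 z ?_ (by simpa using him), hz⟩)
      hε₁ (fun z hz him => hU1 z ⟨h1 z ?_ him, hz⟩)
    · exact Ioo_subset_Icc_self (Complex.mem_reProdIm.1 hz).1
    · exact Ioo_subset_Icc_self (Complex.mem_reProdIm.1 hz).1
  · -- upper bound
    obtain ⟨δ, hδ, h4, hlt⟩ := exists_delta (w := w) hh hε
    obtain ⟨U, hU, hint, hU0, hU1, hen⟩ := exists_testFn hδ h4 hw
    refine ⟨_, ⟨U, ⟨hU.contDiffOn, by rw [hcar]; exact hint, ?_, ?_⟩, rfl⟩, ?_⟩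
    · refine ⟨{z : ℂ | z.im < δ}, isOpen_lt Complex.continuous_im continuous_const,
        fun z hz => ?_, fun z hz => hU0 z (le_of_lt hz.1)⟩
      show z.im < δ
      rw [((Percolation.mem_rectQuad_arc_zero hw hh).1 hz).1]
      exact hδ
    · refine ⟨{z : ℂ | h - δ < z.im}, isOpen_lt continuous_const Complex.continuous_im,
        fun z hz => ?_, fun z hz => hU1 z (le_of_lt hz.1)⟩
      show h - δ < z.im
      rw [((Percolation.mem_rectQuad_arc_two hw hh).1 hz).1]
      linarith
    · rw [hcar]
      exact hen.trans_lt hlt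

end Literature.Probability.RandomPlanarGeometry.ShearModulus

end Part3

/-!
## Part 4 — port of `Summits/CriticalPhenomena/CardyFormulaZ2/Theorems/CardySelfDualSegmentSegmentOpenStubCapacityInvariant.lean` (7 declarations kept)

# Crux `SegmentOpen` , line `Sketch` — stub `stub_capacity_invariant`

Conformal invariance of the set of Dirichlet energies of admissible test functions of a conformal
rectangle (Ahlfors, *Conformal Invariants*, Ch. 4: the Dirichlet integral is a conformal
invariant). Given a conformal equivalence `ψ : R₁.carrier → R₂.carrier` whose boundary values
carry `R₁.arc 0` into `R₂.arc 0` and `R₁.arc 2` into `R₂.arc 2`, every admissible `U` on `R₂`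
pulls back to the admissible `U ∘ ψ` on `R₁` with the same energy: pointwise
`‖d(U ∘ ψ) z‖ = ‖ψ' z‖ · ‖dU (ψ z)‖`, and the real Jacobian of `ψ` is `‖ψ' z‖ ²`
(change of variables `MeasureTheory.integral_image_eq_integral_abs_det_fderiv_smul`). The same
argument for `ψ.symm` gives the reverse inclusion.

(Verbatim declaration-level port — the declarations listed in the Part header count — of the Summits-side module of the CardyFormulaZ2
tree; route / stub bookkeeping in the text above is historical.)
-/

section Part4

namespace Literature.Probability.RandomPlanarGeometry.ShearModulus

open Literature.Probability Literature.Barriers.CriticalPhenomena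
open Literature.Probability.RandomPlanarGeometry (ConformalRectangle ConformalEquiv MarkedDomain)
open _root_.Filter _root_.Set _root_.Topology _root_.MeasureTheory
open _root_.UpperHalfPlane (upperHalfPlaneSet)

/-- Operator norm of a real-linear functional precomposed with complex multiplication by `c`:
`‖ℓ ∘ (c • 1)‖ = ‖c‖ * ‖ℓ‖` (multiplication by `c / ‖c‖` is an isometry of `ℂ`).
[cite: AhlforsBers1960, Thm. 11 (analytic dependence of the modulus; here via the Dirichlet principle — bookkeeping)] -/
private theorem norm_comp_smul_one (ℓ : ℂ →L[ℝ] ℝ) (c : ℂ) :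
    ‖ℓ.comp (c • (1 : ℂ →L[ℝ] ℂ))‖ = ‖c‖ * ‖ℓ‖ := by
  apply le_antisymm
  · refine ContinuousLinearMap.opNorm_le_bound _ (by positivity) fun x => ?_
    calc ‖ℓ.comp (c • (1 : ℂ →L[ℝ] ℂ)) x‖ = ‖ℓ (c * x)‖ := by simp
      _ ≤ ‖ℓ‖ * ‖c * x‖ := ℓ.le_opNorm _
      _ = ‖c‖ * ‖ℓ‖ * ‖x‖ := by rw [norm_mul]; ring
  · rcases eq_or_ne c 0 with rfl | hc
    · simp
    · have hc' : 0 < ‖c‖ := norm_pos_iff.2 hc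
      rw [← le_div_iff₀' hc']
      refine ContinuousLinearMap.opNorm_le_bound _ (by positivity) fun x => ?_
      have hx : ℓ x = ℓ.comp (c • (1 : ℂ →L[ℝ] ℂ)) (c⁻¹ * x) := by
        simp [← mul_assoc, mul_inv_cancel₀ hc]
      rw [hx]
      calc ‖ℓ.comp (c • (1 : ℂ →L[ℝ] ℂ)) (c⁻¹ * x)‖
          ≤ ‖ℓ.comp (c • (1 : ℂ →L[ℝ] ℂ))‖ * ‖c⁻¹ * x‖ := ContinuousLinearMap.le_opNorm _ _
        _ = ‖ℓ.comp (c • (1 : ℂ →L[ℝ] ℂ))‖ / ‖c‖ * ‖x‖ := by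
          rw [norm_mul, norm_inv]; ring

/-- The real Jacobian determinant of complex multiplication by `c` is `‖c‖ ^ 2`.
[cite: AhlforsBers1960, Thm. 11 (analytic dependence of the modulus; here via the Dirichlet principle — bookkeeping)] -/
private theorem det_smul_one (c : ℂ) : (c • (1 : ℂ →L[ℝ] ℂ)).det = ‖c‖ ^ 2 := by
  have h : ((c • (1 : ℂ →L[ℝ] ℂ) : ℂ →L[ℝ] ℂ) : ℂ →ₗ[ℝ] ℂ) = Algebra.lmul ℝ ℂ c := by
    ext w
    simp
  rw [ContinuousLinearMap.det, h]
  change LinearMap.det (Algebra.lmul ℝ ℂ c) = _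
  rw [← Algebra.norm_apply, Algebra.norm_complex_apply, Complex.normSq_eq_norm_sq]

/-- Transport of a locally constant boundary condition along boundary values: if `ψ` maps `S₁`
into `S₂`, tends within `S₁` at every point of `A₁` to a point of `A₂`, and `U = a` on `O ∩ S₂` for
an open `O ⊇ A₂`, then `U ∘ ψ = a` on `O' ∩ S₁` for an open `O' ⊇ A₁`.
[cite: AhlforsBers1960, Thm. 11 (analytic dependence of the modulus; here via the Dirichlet principle — bookkeeping)] -/
private theorem boundaryCondition_comp {S₁ S₂ A₁ A₂ : Set ℂ} (ψ : ℂ → ℂ) (hmaps : MapsTo ψ S₁ S₂)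
    (hbv : ∀ z ∈ A₁, ∃ p ∈ A₂, Tendsto ψ (𝓝[S₁] z) (𝓝 p)) {U : ℂ → ℝ} {a : ℝ}
    (hU : ∃ O : Set ℂ, IsOpen O ∧ A₂ ⊆ O ∧ ∀ z ∈ O ∩ S₂, U z = a) :
    ∃ O : Set ℂ, IsOpen O ∧ A₁ ⊆ O ∧ ∀ z ∈ O ∩ S₁, U (ψ z) = a := by
  obtain ⟨O, hO, hAO, hUO⟩ := hU
  have key : ∀ z ∈ A₁, ∃ W : Set ℂ, IsOpen W ∧ z ∈ W ∧ ∀ w ∈ W ∩ S₁, ψ w ∈ O := by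
    intro z hz
    obtain ⟨p, hp, hT⟩ := hbv z hz
    have hmem : ψ ⁻¹' O ∈ 𝓝[S₁] z := hT (hO.mem_nhds (hAO hp))
    obtain ⟨W, hW, hzW, hWsub⟩ := mem_nhdsWithin.1 hmem
    exact ⟨W, hW, hzW, fun w hw => hWsub hw⟩
  choose! W hWo hzW hWψ using key
  refine ⟨⋃ z ∈ A₁, W z, isOpen_biUnion fun z hz => hWo z hz,
    fun z hz => mem_biUnion hz (hzW z hz), ?_⟩
  rintro w ⟨hw, hwS⟩
  obtain ⟨z, hz, hwz⟩ := mem_iUnion₂.1 hw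
  exact hUO _ ⟨hWψ z hz w ⟨hwz, hwS⟩, hmaps hwS⟩

/-- Chain rule for `U ∘ ψ` with `ψ` a conformal equivalence between open sets and `U` of class
`C¹` on the target: the real derivative is `dU (ψ z) ∘ (ψ' z • 1)`.
[cite: AhlforsBers1960, Thm. 11 (analytic dependence of the modulus; here via the Dirichlet principle — bookkeeping)] -/
private theorem hasFDerivAt_comp_conformal {S₁ S₂ : Set ℂ} (ψ : ConformalEquiv S₁ S₂)
    (hS₁ : IsOpen S₁) (hS₂ : IsOpen S₂) {U : ℂ → ℝ} (hU : ContDiffOn ℝ 1 U S₂) {z : ℂ}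
    (hz : z ∈ S₁) :
    HasFDerivAt (fun w => U (ψ w))
      ((fderiv ℝ U (ψ z)).comp (deriv ψ z • (1 : ℂ →L[ℝ] ℂ))) z := by
  have hψ : HasFDerivAt ψ (deriv ψ z • (1 : ℂ →L[ℝ] ℂ)) z :=
    ((ψ.differentiableOn_coe z hz).differentiableAt (hS₁.mem_nhds hz)).hasDerivAt
      |>.complexToReal_fderiv
  have hUd : HasFDerivAt U (fderiv ℝ U (ψ z)) (ψ z) :=
    ((hU.differentiableOn_one (ψ z) (ψ.mapsTo hz)).differentiableAt
      (hS₂.mem_nhds (ψ.mapsTo hz))).hasFDerivAt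
  exact hUd.comp z hψ

/-- Pointwise energy identity: `‖d(U ∘ ψ) z‖ ² = ‖ψ' z‖ ² · ‖dU (ψ z)‖ ²`.
[cite: AhlforsBers1960, Thm. 11 (analytic dependence of the modulus; here via the Dirichlet principle — bookkeeping)] -/
private theorem norm_fderiv_comp_conformal_sq {S₁ S₂ : Set ℂ} (ψ : ConformalEquiv S₁ S₂)
    (hS₁ : IsOpen S₁) (hS₂ : IsOpen S₂) {U : ℂ → ℝ} (hU : ContDiffOn ℝ 1 U S₂) {z : ℂ}
    (hz : z ∈ S₁) :
    ‖fderiv ℝ (fun w => U (ψ w)) z‖ ^ 2 = ‖deriv ψ z‖ ^ 2 * ‖fderiv ℝ U (ψ z)‖ ^ 2 := by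
  rw [(hasFDerivAt_comp_conformal ψ hS₁ hS₂ hU hz).fderiv, norm_comp_smul_one, mul_pow]

/-- One inclusion of the conformal invariance of admissible energies: pulling back admissible
test functions of `R₂` along `ψ : R₁.carrier → R₂.carrier` (boundary values of `ψ` carrying
`R₁.arc 0` into `R₂.arc 0` and `R₁.arc 2` into `R₂.arc 2`) gives admissible test functions of
`R₁` with the same Dirichlet energy.
[cite: AhlforsBers1960, Thm. 11 (analytic dependence of the modulus; here via the Dirichlet principle — bookkeeping)] -/
private theorem energySet_subset (R₁ R₂ : ConformalRectangle)
    (ψ : ConformalEquiv R₁.carrier R₂.carrier)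
    (h₀ : ∀ z ∈ R₁.arc 0, ∃ p ∈ R₂.arc 0, ψ.HasBoundaryValue z p)
    (h₂ : ∀ z ∈ R₁.arc 2, ∃ p ∈ R₂.arc 2, ψ.HasBoundaryValue z p) :
    {e : ℝ | ∃ U : ℂ → ℝ,
        (ContDiffOn ℝ 1 U R₂.carrier ∧
          IntegrableOn (fun z => ‖fderiv ℝ U z‖ ^ 2) R₂.carrier ∧
          (∃ O : Set ℂ, IsOpen O ∧ R₂.arc 0 ⊆ O ∧ ∀ z ∈ O ∩ R₂.carrier, U z = 0) ∧
          (∃ O : Set ℂ, IsOpen O ∧ R₂.arc 2 ⊆ O ∧ ∀ z ∈ O ∩ R₂.carrier, U z = 1)) ∧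
        e = ∫ z in R₂.carrier, ‖fderiv ℝ U z‖ ^ 2} ⊆
    {e : ℝ | ∃ U : ℂ → ℝ,
        (ContDiffOn ℝ 1 U R₁.carrier ∧
          IntegrableOn (fun z => ‖fderiv ℝ U z‖ ^ 2) R₁.carrier ∧
          (∃ O : Set ℂ, IsOpen O ∧ R₁.arc 0 ⊆ O ∧ ∀ z ∈ O ∩ R₁.carrier, U z = 0) ∧
          (∃ O : Set ℂ, IsOpen O ∧ R₁.arc 2 ⊆ O ∧ ∀ z ∈ O ∩ R₁.carrier, U z = 1)) ∧
        e = ∫ z in R₁.carrier, ‖fderiv ℝ U z‖ ^ 2} := by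
  rintro e ⟨U, ⟨hU₁, hU₂, hU₃, hU₄⟩, rfl⟩
  have hO₁ : IsOpen R₁.carrier := R₁.isOpen
  have hO₂ : IsOpen R₂.carrier := R₂.isOpen
  -- the real derivative of `ψ` within the carrier, and the change-of-variables data
  have hd : ∀ x ∈ R₁.carrier,
      HasFDerivWithinAt ψ (deriv ψ x • (1 : ℂ →L[ℝ] ℂ)) R₁.carrier x := fun x hx =>
    (((ψ.differentiableOn_coe x hx).differentiableAt (hO₁.mem_nhds hx)).hasDerivAt
      |>.complexToReal_fderiv).hasFDerivWithinAt
  have himage : ψ '' R₁.carrier = R₂.carrier := ψ.bijOn.image_eq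
  have hpt : ∀ x ∈ R₁.carrier,
      |(deriv ψ x • (1 : ℂ →L[ℝ] ℂ)).det| • ‖fderiv ℝ U (ψ x)‖ ^ 2 =
        ‖fderiv ℝ (fun w => U (ψ w)) x‖ ^ 2 := fun x hx => by
    rw [det_smul_one, abs_of_nonneg (by positivity), smul_eq_mul,
      norm_fderiv_comp_conformal_sq ψ hO₁ hO₂ hU₁ hx]
  refine ⟨fun z => U (ψ z), ⟨?_, ?_, ?_, ?_⟩, ?_⟩
  · -- `C¹`: holomorphic maps are smooth on open sets
    exact hU₁.comp ((ψ.differentiableOn_coe.contDiffOn hO₁).restrict_scalars ℝ) ψ.mapsTo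
  · -- finite energy, by the change of variables
    have hint := (integrableOn_image_iff_integrableOn_abs_det_fderiv_smul volume
      hO₁.measurableSet hd ψ.injOn (fun z => ‖fderiv ℝ U z‖ ^ 2)).1 (by rwa [himage])
    exact hint.congr_fun (fun x hx => hpt x hx) hO₁.measurableSet
  · exact boundaryCondition_comp ψ ψ.mapsTo h₀ hU₃
  · exact boundaryCondition_comp ψ ψ.mapsTo h₂ hU₄
  · -- equality of energies, by the change of variables
    have hcv := integral_image_eq_integral_abs_det_fderiv_smul volume hO₁.measurableSet hd
      ψ.injOn (fun z => ‖fderiv ℝ U z‖ ^ 2)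
    rw [himage] at hcv
    rw [hcv]
    exact setIntegral_congr_fun hO₁.measurableSet fun x hx => hpt x hx

/-- **Conformal invariance of the set of admissible Dirichlet energies** (Ahlfors, *Conformal
Invariants*, Ch. 4). A conformal equivalence `ψ : R₁.carrier → R₂.carrier` between conformal
rectangles whose boundary values carry `R₁.arc 0` into `R₂.arc 0` and `R₁.arc 2` into
`R₂.arc 2`, and whose inverse does the same backwards, identifies the sets of Dirichlet energies
`∫ ‖dU‖ ²` of admissible test functions (`C¹` on the carrier, finite energy, `= 0` near `arc 0`,
`= 1` near `arc 2`): `U ↦ U ∘ ψ` and `V ↦ V ∘ ψ⁻¹` preserve admissibility and energy, since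
`‖d(U ∘ ψ) z‖ = ‖ψ' z‖ ‖dU (ψ z)‖` and the real Jacobian of `ψ` is `‖ψ'‖ ²`.
[cite: AhlforsBers1960, Thm. 11 (analytic dependence of the modulus; here via the Dirichlet principle — bookkeeping)] -/
theorem stub_capacity_invariant :
    ∀ (R₁ R₂ : ConformalRectangle) (ψ : ConformalEquiv R₁.carrier R₂.carrier),
      (∀ z ∈ R₁.arc 0, ∃ p ∈ R₂.arc 0, ψ.HasBoundaryValue z p) →
      (∀ z ∈ R₁.arc 2, ∃ p ∈ R₂.arc 2, ψ.HasBoundaryValue z p) →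
      (∀ p ∈ R₂.arc 0, ∃ z ∈ R₁.arc 0, ψ.symm.HasBoundaryValue p z) →
      (∀ p ∈ R₂.arc 2, ∃ z ∈ R₁.arc 2, ψ.symm.HasBoundaryValue p z) →
      {e : ℝ | ∃ U : ℂ → ℝ,
          (ContDiffOn ℝ 1 U R₁.carrier ∧
            IntegrableOn (fun z => ‖fderiv ℝ U z‖ ^ 2) R₁.carrier ∧
            (∃ O : Set ℂ, IsOpen O ∧ R₁.arc 0 ⊆ O ∧ ∀ z ∈ O ∩ R₁.carrier, U z = 0) ∧
            (∃ O : Set ℂ, IsOpen O ∧ R₁.arc 2 ⊆ O ∧ ∀ z ∈ O ∩ R₁.carrier, U z = 1)) ∧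
          e = ∫ z in R₁.carrier, ‖fderiv ℝ U z‖ ^ 2} =
      {e : ℝ | ∃ U : ℂ → ℝ,
          (ContDiffOn ℝ 1 U R₂.carrier ∧
            IntegrableOn (fun z => ‖fderiv ℝ U z‖ ^ 2) R₂.carrier ∧
            (∃ O : Set ℂ, IsOpen O ∧ R₂.arc 0 ⊆ O ∧ ∀ z ∈ O ∩ R₂.carrier, U z = 0) ∧
            (∃ O : Set ℂ, IsOpen O ∧ R₂.arc 2 ⊆ O ∧ ∀ z ∈ O ∩ R₂.carrier, U z = 1)) ∧
          e = ∫ z in R₂.carrier, ‖fderiv ℝ U z‖ ^ 2} := by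
  intro R₁ R₂ ψ h₀ h₂ h₀' h₂'
  exact Subset.antisymm (energySet_subset R₂ R₁ ψ.symm h₀' h₂') (energySet_subset R₁ R₂ ψ h₀ h₂)

end Literature.Probability.RandomPlanarGeometry.ShearModulus

end Part4

/-!
## Part 5 — port of `Summits/CriticalPhenomena/CardyFormulaZ2/Theorems/CardySelfDualSegmentSegmentOpenStubRectUniformization.lean` (3 declarations kept)

# Crux `SegmentOpen` , line `Sketch` — stub `stub_rectUniformization`

**Every conformal rectangle is conformally equivalent to a rectangle with the vertices
corresponding** (Ahlfors, *Conformal Invariants* (1973), Ch. 4; Lehto–Virtanen, I §2.4;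
Pommerenke (1992), §2.3 Exercise 2), in the form consumed by the Dirichlet-principle route to
`ShearCrossRatioAnalytic`: for every conformal rectangle `R` with a uniformizing datum `(φ, x)`
there are a model rectangle `S = rectQuad 0 w 0 h` (here `w = 1`) with `λ(i h/w) = crossRatio x`
and a conformal equivalence `ψ : S.carrier → R.carrier` whose boundary values carry the bottom
side `S.arc 0` into `R.arc 0` and the top side `S.arc 2` into `R.arc 2`, the inverse doing the
same backwards.

Proof. (1) `h` with `λ(ih) = crossRatio x ∈ (0,1)` exists by the intermediate value theorem
(`exists_lamR_eq`: `λ(it)` is continuous on `(0,∞)`, tends to `0` at `+∞` and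
`λ(i/t) = 1 - λ(it)`). (2) Every uniformizing datum of `S` has cross-ratio `λ(i h/w)`
(`rectQuad_crossRatio_eq_lamR`: the similarity `z ↦ -iz + iw` carries `S` onto the corner-marked
rectangle of `rectangle_crossRatio_eq_lamR`, and the cross-ratio is invariant under univalent
maps, `ConformalRectangle.crossRatio_eq_of_image_data`). (3) Both `S` and `R` carry uniformizing
data `(φ_S, ξ)`, `(φ_R, y)` with the two-sided arc correspondence
(`MarkedDomain.exists_uniformizing_arcCorrespondence`, `UniformizingArcCorrespondence.lean`:
Riemann mapping + Carathéodory); `crossRatio ξ = λ(ih/w) = crossRatio x = crossRatio y` by (2)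
and conformal invariance (`crossRatio_eq_of_isUniformizing_holds`). (4) The matching lemma
`exists_moebius_match` (`MoebiusMatching.lean`) gives a real Möbius automorphism `M` of `ℍₒ`
(`exists_moebius_conformalEquiv`, `HalfPlaneMoebius.lean`) carrying `[ξ₀, ξ₁]` into `[y₀, y₁]`
and `[ξ₂, ξ₃]` into `[y₂, y₃]` off its pole, and backwards. (5) `ψ = φ_R ∘ M ∘ φ_S⁻¹`; its
boundary values are composed from the three pieces (`moebius_tendsto_ofReal` for the middle one).

## References

* L. V. Ahlfors, *Conformal Invariants* (1973), Ch. 4 (extremal length; the rectangle).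
* Ch. Pommerenke, *Boundary Behaviour of Conformal Maps* (1992), Thm. 2.6, Cor. 2.7, §2.3 Ex. 2.
* P. Kleban, D. Zagier, *Crossing probabilities and modular forms*, J. Stat. Phys. 113 (2003), §3.

(Verbatim declaration-level port — the declarations listed in the Part header count — of the Summits-side module of the CardyFormulaZ2
tree; route / stub bookkeeping in the text above is historical.)
-/

section Part5

namespace Literature.Probability.RandomPlanarGeometry.ShearModulus

open Literature.Probability Literature.Barriers.CriticalPhenomena
open Literature.Probability.RandomPlanarGeometry (ConformalRectangle ConformalEquiv MarkedDomain)
open _root_.Filter _root_.Set _root_.Topology _root_.MeasureTheory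
open _root_.UpperHalfPlane (upperHalfPlaneSet)

section AspectRatio

open RandomPlanarGeometry.KlebanZagier

/-- **Every modulus in `(0,1)` is `λ(im)` for some aspect ratio `m > 0`**: `t ↦ λ(it)` is
continuous on `(0, ∞)` (`hasDerivAt_lamR`), tends to `0` at `+∞` (`tendsto_lamR_atTop`) and
satisfies `λ(i/t) = 1 - λ(it)` (`lamR_inv`), so it takes values below `η` at a large `b` and
above `η` at `1/b`; conclude by the intermediate value theorem.
[cite: AhlforsBers1960, Thm. 11 (analytic dependence of the modulus; here via the Dirichlet principle — bookkeeping)] -/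
theorem exists_lamR_eq {η : ℝ} (hη : η ∈ Ioo (0 : ℝ) 1) : ∃ m : ℝ, 0 < m ∧ lamR m = η := by
  have hε : 0 < min η (1 - η) := lt_min hη.1 (by linarith [hη.2])
  obtain ⟨b, hb0, hbε⟩ : ∃ b : ℝ, 0 < b ∧ lamR b < min η (1 - η) := by
    have h1 : ∀ᶠ t in atTop, lamR t < min η (1 - η) := tendsto_lamR_atTop (Iio_mem_nhds hε)
    exact ((eventually_gt_atTop 0).and h1).exists
  have hb1 : lamR b < η := hbε.trans_le (min_le_left _ _)
  have hb2 : η < lamR b⁻¹ := by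
    rw [lamR_inv hb0]
    have := min_le_right η (1 - η)
    linarith
  have hpos : ∀ t ∈ uIcc b⁻¹ b, 0 < t := fun t ht => by
    rcases mem_uIcc.1 ht with h | h
    · exact (inv_pos.2 hb0).trans_le h.1
    · exact hb0.trans_le h.1
  have hcont : ContinuousOn lamR (uIcc b⁻¹ b) :=
    continuousOn_of_forall_continuousAt fun t ht => (hasDerivAt_lamR (hpos t ht)).continuousAt
  obtain ⟨m, hm, hmη⟩ := intermediate_value_uIcc hcont (Icc_subset_uIcc' ⟨hb1.le, hb2.le⟩)
  exact ⟨m, hpos m hm, hmη⟩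

end AspectRatio

section ModelRectangle

open _root_.Complex Literature.Probability.RandomPlanarGeometry Literature.Probability.Percolation

/-- **The Cardy cross-ratio of the model rectangle.** Every uniformizing datum of
`rectQuad 0 w 0 h` (corners `0, w, w + ih, ih` marked counterclockwise from `0`, read off the
side descriptions `mem_rectQuad_arc_*`) has cross-ratio `λ(i h/w)`: the similarity
`z ↦ -iz + iw` carries it onto the rectangle `(0,h) × (0,w)` with the corner marking
`(iw, 0, h, h + iw)` of `rectangle_crossRatio_eq_lamR` (Kleban–Zagier 2003, §3), and the
cross-ratio is invariant under univalent maps of the closure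
(`ConformalRectangle.crossRatio_eq_of_image_data`).
[cite: AhlforsBers1960, Thm. 11 (analytic dependence of the modulus; here via the Dirichlet principle — bookkeeping)] -/
theorem rectQuad_crossRatio_eq_lamR {w h : ℝ} (hw : 0 < w) (hh : 0 < h)
    (φ : ConformalEquiv upperHalfPlaneSet (rectQuad 0 w 0 h hw hh).carrier) (x : Fin 4 → ℝ)
    (hu : (rectQuad 0 w 0 h hw hh).IsUniformizing φ x) :
    crossRatio x = KlebanZagier.lamR (h / w) := by
  set Q := rectQuad 0 w 0 h hw hh with hQ
  -- the corners of the model rectangle (adapted from `exists_diamond_shear_chart`)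
  have a0 : Q.pt 0 ∈ Q.arc 0 := Q.pt_mem_arc_self 0
  have a1 : Q.pt 1 ∈ Q.arc 1 := Q.pt_mem_arc_self 1
  have a2 : Q.pt 2 ∈ Q.arc 2 := Q.pt_mem_arc_self 2
  have a3 : Q.pt 3 ∈ Q.arc 3 := Q.pt_mem_arc_self 3
  have b3 : Q.pt 0 ∈ Q.arc 3 := by simpa using Q.pt_succ_mem_arc 3
  have b0 : Q.pt 1 ∈ Q.arc 0 := by simpa using Q.pt_succ_mem_arc 0
  have b1 : Q.pt 2 ∈ Q.arc 1 := by simpa using Q.pt_succ_mem_arc 1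
  have b2 : Q.pt 3 ∈ Q.arc 2 := by simpa using Q.pt_succ_mem_arc 2
  rw [mem_rectQuad_arc_zero] at a0 b0
  rw [mem_rectQuad_arc_one] at a1 b1
  rw [mem_rectQuad_arc_two] at a2 b2
  rw [mem_rectQuad_arc_three] at a3 b3
  have p0 : Q.pt 0 = 0 := by
    apply Complex.ext <;> simp [a0.1, b3.1]
  have p1 : Q.pt 1 = w := by
    apply Complex.ext <;> simp [a1.1, b0.1]
  have p2 : Q.pt 2 = w + h * I := by
    apply Complex.ext <;> simp [a2.1, b1.1]
  have p3 : Q.pt 3 = h * I := by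
    apply Complex.ext <;> simp [a3.1, b2.1]
  -- the similarity `g z = -i z + i w` (rotation by `-π/2`, then translation by `iw`)
  set g : ℂ → ℂ := fun z => -I * z + I * w with hg
  have hcont : Continuous g := by rw [hg]; fun_prop
  have hdiff : Differentiable ℂ g := by rw [hg]; fun_prop
  have hinj : Function.Injective g := by
    intro z z' hzz'
    have e : -I * z = -I * z' := add_right_cancel hzz'
    exact mul_left_cancel₀ (neg_ne_zero.2 I_ne_zero) e
  have key : ∀ u : ℂ, g u = ⟨u.im, w - u.re⟩ := fun u => by
    apply Complex.ext
    · simp [hg]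
    · simp [hg]; ring
  obtain ⟨S', hS'c, hS'p⟩ := Q.exists_image g hcont.continuousOn hinj.injOn
  have hS'c' : S'.carrier = (Ioo (0 : ℝ) h ×ℂ Ioo (0 : ℝ) w) := by
    rw [hS'c, hQ, rectQuad_carrier]
    ext z
    simp only [mem_image, key, Complex.mem_reProdIm, mem_Ioo]
    constructor
    · rintro ⟨u, ⟨⟨h1, h2⟩, h3, h4⟩, rfl⟩
      refine ⟨⟨?_, ?_⟩, ?_, ?_⟩ <;> dsimp only <;> linarith
    · rintro ⟨⟨h1, h2⟩, h3, h4⟩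
      refine ⟨⟨w - z.im, z.re⟩, ⟨⟨?_, ?_⟩, ?_, ?_⟩, ?_⟩
      · dsimp only; linarith
      · dsimp only; linarith
      · dsimp only; linarith
      · dsimp only; linarith
      · apply Complex.ext
        · rfl
        · show w - (w - z.im) = z.im
          ring
  have hS'p' : S'.pt 0 = (w : ℂ) * Complex.I ∧ S'.pt 1 = 0 ∧ S'.pt 2 = (h : ℂ) ∧
      S'.pt 3 = (h : ℂ) + (w : ℂ) * Complex.I := by
    refine ⟨?_, ?_, ?_, ?_⟩
    · rw [hS'p, p0, key]; apply Complex.ext <;> simp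
    · rw [hS'p, p1, key]; apply Complex.ext <;> simp
    · rw [hS'p, p2, key]; apply Complex.ext <;> simp
    · rw [hS'p, p3, key]; apply Complex.ext <;> simp
  obtain ⟨ψ, y, hψ⟩ := MarkedDomain.exists_isUniformizing_holds S'
  rw [← rectangle_crossRatio_eq_lamR S' hh hw hS'c' hS'p' ψ y hψ]
  exact ConformalRectangle.crossRatio_eq_of_image_data hdiff.differentiableOn hinj.injOn
    hcont.continuousOn hS'c hS'p hu hψ

end ModelRectangle

/-- **Rectangle uniformization with vertex and side correspondence** (Ahlfors, *Conformal
Invariants* (1973), Ch. 4; Pommerenke (1992), §2.3 Exercise 2: "every quadrilateral is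
conformally equivalent to a rectangle, the vertices corresponding"). For every conformal
rectangle `R` with uniformizing datum `(φ, x)` there are `w, h > 0` with
`λ(i h/w) = crossRatio x` and a conformal equivalence `ψ` of the model rectangle
`rectQuad 0 w 0 h` onto `R.carrier` such that: every point of the bottom side `arc 0` (resp. the
top side `arc 2`) of the model rectangle is carried by the boundary values of `ψ` to a point of
`R.arc 0` (resp. `R.arc 2`), and every point of `R.arc 0` (resp. `R.arc 2`) is carried by the
boundary values of `ψ⁻¹` to a point of the bottom (resp. top) side. Proof: `w = 1`, `h` by the
intermediate value theorem for `λ`; `ψ = φ_R ∘ M ∘ φ_S⁻¹` for uniformizing data of `S` and `R`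
with arc correspondence (`MarkedDomain.exists_uniformizing_arcCorrespondence`) and the Möbius
matching `M` of their real marks (`exists_moebius_match`), possible since the two data have the
same cross-ratio `λ(ih) = crossRatio x`.
[cite: AhlforsBers1960, Thm. 11 (analytic dependence of the modulus; here via the Dirichlet principle — bookkeeping)] -/
theorem stub_rectUniformization :
    ∀ (R : ConformalRectangle) (φ : ConformalEquiv upperHalfPlaneSet R.carrier) (x : Fin 4 → ℝ),
      R.IsUniformizing φ x →
      ∃ (w h : ℝ) (hw : 0 < w) (hh : 0 < h),
        RandomPlanarGeometry.KlebanZagier.lamR (h / w) = RandomPlanarGeometry.crossRatio x ∧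
        ∃ ψ : ConformalEquiv (Percolation.rectQuad 0 w 0 h hw hh).carrier R.carrier,
          (∀ z ∈ (Percolation.rectQuad 0 w 0 h hw hh).arc 0, ∃ p ∈ R.arc 0,
            ψ.HasBoundaryValue z p) ∧
          (∀ z ∈ (Percolation.rectQuad 0 w 0 h hw hh).arc 2, ∃ p ∈ R.arc 2,
            ψ.HasBoundaryValue z p) ∧
          (∀ p ∈ R.arc 0, ∃ z ∈ (Percolation.rectQuad 0 w 0 h hw hh).arc 0,
            ψ.symm.HasBoundaryValue p z) ∧
          (∀ p ∈ R.arc 2, ∃ z ∈ (Percolation.rectQuad 0 w 0 h hw hh).arc 2,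
            ψ.symm.HasBoundaryValue p z) := by
  intro R φ x hux
  -- (1) the aspect ratio
  obtain ⟨m, hm, hlam⟩ :=
    exists_lamR_eq (ConformalRectangle.crossRatio_mem_Ioo_of_isUniformizing hux)
  refine ⟨1, m, one_pos, hm, by rwa [div_one], ?_⟩
  set S := Percolation.rectQuad 0 1 0 m one_pos hm with hS
  -- (3) uniformizing data with arc correspondence for `S` and `R`
  obtain ⟨φS, ξ, huS, hSarc⟩ := S.exists_uniformizing_arcCorrespondence
  obtain ⟨φR, y, huR, hRarc⟩ := R.exists_uniformizing_arcCorrespondence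
  obtain ⟨hS0, hS0'⟩ := hSarc 0 1 (Percolation.SquareModel.nextMark_zero S)
  obtain ⟨hS2, hS2'⟩ := hSarc 2 3 (Percolation.SquareModel.nextMark_two S)
  obtain ⟨hR0, hR0'⟩ := hRarc 0 1 (Percolation.SquareModel.nextMark_zero R)
  obtain ⟨hR2, hR2'⟩ := hRarc 2 3 (Percolation.SquareModel.nextMark_two R)
  -- (2) the two data have the same cross-ratio
  have hcr : RandomPlanarGeometry.crossRatio ξ = RandomPlanarGeometry.crossRatio y := by
    rw [rectQuad_crossRatio_eq_lamR one_pos hm φS ξ huS, div_one, hlam]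
    exact ConformalRectangle.crossRatio_eq_of_isUniformizing_holds hux huR
  -- (4) the Möbius matching of the real marks
  obtain ⟨a, b, c, d, hdet, h01, h23, h01', h23'⟩ :=
    RandomPlanarGeometry.exists_moebius_match ξ y huS.1 huR.1 hcr
  have hdet' : 0 < d * a - -b * -c := by linarith
  obtain ⟨M, hM, hMsymm⟩ := RandomPlanarGeometry.exists_moebius_conformalEquiv hdet
  -- (5) the composite `ψ = φ_R ∘ M ∘ φ_S⁻¹` and its boundary values
  have fwd : ∀ {A B : Set ℂ} {B' : Set ℝ},
      (∀ z ∈ A, ∃ r ∈ B', Tendsto φS.symm (𝓝[S.carrier] z) (𝓝[upperHalfPlaneSet] (r : ℂ))) →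
      (∀ t ∈ B', c * t + d ≠ 0 ∧ ∃ p ∈ B,
        Tendsto φR (𝓝[upperHalfPlaneSet] (((a * t + b) / (c * t + d) : ℝ) : ℂ)) (𝓝 p)) →
      ∀ z ∈ A, ∃ p ∈ B, (φS.symm.trans (M.trans φR)).HasBoundaryValue z p := by
    intro A B B' hA hB z hz
    obtain ⟨r, hr, h1⟩ := hA z hz
    obtain ⟨hden, p, hp, h3⟩ := hB r hr
    refine ⟨p, hp, ?_⟩
    have h := h3.comp ((RandomPlanarGeometry.moebius_tendsto_ofReal hdet hden).comp h1)
    refine h.congr fun v => ?_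
    simp only [Function.comp_apply, ConformalEquiv.trans_apply, hM]
  have bwd : ∀ {A B : Set ℂ} {B' : Set ℝ},
      (∀ p ∈ B, ∃ u ∈ B', Tendsto φR.symm (𝓝[R.carrier] p) (𝓝[upperHalfPlaneSet] (u : ℂ))) →
      (∀ u ∈ B', -c * u + a ≠ 0 ∧ ∃ z ∈ A,
        Tendsto φS (𝓝[upperHalfPlaneSet] (((d * u + -b) / (-c * u + a) : ℝ) : ℂ)) (𝓝 z)) →
      ∀ p ∈ B, ∃ z ∈ A, (φS.symm.trans (M.trans φR)).symm.HasBoundaryValue p z := by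
    intro A B B' hB hA p hp
    obtain ⟨u, hu, h1⟩ := hB p hp
    obtain ⟨hden, z, hz, h3⟩ := hA u hu
    refine ⟨z, hz, ?_⟩
    have h := h3.comp ((RandomPlanarGeometry.moebius_tendsto_ofReal hdet' hden).comp h1)
    refine h.congr fun v => ?_
    simp only [Function.comp_apply]
    show φS (((d : ℂ) * φR.symm v + ((-b : ℝ) : ℂ)) / (((-c : ℝ) : ℂ) * φR.symm v + a)) =
      φS (M.symm (φR.symm v))
    rw [hMsymm]
  refine ⟨φS.symm.trans (M.trans φR), ?_, ?_, ?_, ?_⟩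
  · exact fwd hS0 fun t ht => ⟨(h01 t ht).1, hR0' _ (h01 t ht).2⟩
  · exact fwd hS2 fun t ht => ⟨(h23 t ht).1, hR2' _ (h23 t ht).2⟩
  · exact bwd hR0 fun u hu => ⟨(h01' u hu).1, hS0' _ (h01' u hu).2⟩
  · exact bwd hR2 fun u hu => ⟨(h23' u hu).1, hS2' _ (h23' u hu).2⟩

end Literature.Probability.RandomPlanarGeometry.ShearModulus

end Part5

/-!
## Part 6 — port of `Summits/CriticalPhenomena/CardyFormulaZ2/Theorems/CardySelfDualSegmentSegmentOpenStubShearCrossRatioAnalytic.lean` (4 declarations kept)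

# Crux `SegmentOpen` , line `Sketch` — stub `stub_shearCrossRatioAnalytic` (S7)

S7 of line `Sketch` is, verbatim, the Literature named fact
`Literature.Probability.RandomPlanarGeometry.ShearCrossRatioAnalytic` (the conformal modulus of
Beffara's sheared quad `φ_α R'` is a real-analytic function of the shear `α` on the upper
half-plane).  This file PROVES it — unconditionally, without quasiconformal theory — by the
DIRICHLET-PRINCIPLE ROUTE from the five landed stubs of the line:

* RU `stub_rectUniformization` (p129662): every conformal rectangle is conformally a model rectangle
  `rectQuad 0 w 0 h` with `λ(i h/w) = crossRatio`, with two-sided correspondence of arcs 0 and 2;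
* DPinv `stub_capacity_invariant` (p128045): such an equivalence identifies the sets of admissible
  Dirichlet energies;
* DPrect `stub_rectCapacity` (p128591): the infimum of the admissible energies of `rectQuad 0 w 0 h`
  is `w / h`;
* SH `stub_shearCapacity_eq` (p128176): the admissible energies of `φ_α R'` are the `α`-anisotropic
  energies of the admissible class of `R'`;
* AN `stub_shearEnergyAnalytic` (p130291): their infimum `E_{R'}(α)` is real-analytic on `{im α > 0}`.

Hence `crossRatio x = λ(1 / E_{R'}(α))` for every presentation of `φ_α R'`
(`crossRatio_shear_eq_lamR`), and `M := λ ∘ (·)⁻¹ ∘ E_{R'}` is real-analytic (`analyticAt_lamR`):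
`stub_shearCrossRatioAnalytic`, and the Literature fact `shearCrossRatioAnalytic_holds`.

(Verbatim declaration-level port — the declarations listed in the Part header count — of the Summits-side module of the CardyFormulaZ2
tree; route / stub bookkeeping in the text above is historical.)
-/

section Part6

namespace Literature.Probability.RandomPlanarGeometry.ShearModulus

open Literature.Probability Literature.Barriers.CriticalPhenomena
open Literature.Probability.RandomPlanarGeometry (ConformalRectangle ConformalEquiv MarkedDomain)
open _root_.Filter _root_.Set _root_.Topology _root_.MeasureTheory
open _root_.UpperHalfPlane (upperHalfPlaneSet)

namespace ShearCrossRatioAnalyticProof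

/-- RU + DPinv + DPrect: the infimum `Cap R` of the admissible Dirichlet energies of a conformal
rectangle is positive and the Cardy cross-ratio of every uniformizing datum is `λ(i / Cap R)`.
[cite: AhlforsBers1960, Thm. 11 (analytic dependence of the modulus; here via the Dirichlet principle — bookkeeping)] -/
theorem crossRatio_eq_lamR_inv_cap (R : ConformalRectangle)
    (φ : ConformalEquiv upperHalfPlaneSet R.carrier) (x : Fin 4 → ℝ) (hφ : R.IsUniformizing φ x) :
    0 < sInf {e : ℝ | ∃ U : ℂ → ℝ,
          (ContDiffOn ℝ 1 U R.carrier ∧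
            IntegrableOn (fun z => ‖fderiv ℝ U z‖ ^ 2) R.carrier ∧
            (∃ O : Set ℂ, IsOpen O ∧ R.arc 0 ⊆ O ∧ ∀ z ∈ O ∩ R.carrier, U z = 0) ∧
            (∃ O : Set ℂ, IsOpen O ∧ R.arc 2 ⊆ O ∧ ∀ z ∈ O ∩ R.carrier, U z = 1)) ∧
          e = ∫ z in R.carrier, ‖fderiv ℝ U z‖ ^ 2} ∧
      RandomPlanarGeometry.crossRatio x = RandomPlanarGeometry.KlebanZagier.lamR
        (sInf {e : ℝ | ∃ U : ℂ → ℝ,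
          (ContDiffOn ℝ 1 U R.carrier ∧
            IntegrableOn (fun z => ‖fderiv ℝ U z‖ ^ 2) R.carrier ∧
            (∃ O : Set ℂ, IsOpen O ∧ R.arc 0 ⊆ O ∧ ∀ z ∈ O ∩ R.carrier, U z = 0) ∧
            (∃ O : Set ℂ, IsOpen O ∧ R.arc 2 ⊆ O ∧ ∀ z ∈ O ∩ R.carrier, U z = 1)) ∧
          e = ∫ z in R.carrier, ‖fderiv ℝ U z‖ ^ 2})⁻¹ := by
  obtain ⟨w, h, hw, hh, hlam, ψ, h0, h2, h0', h2'⟩ := stub_rectUniformization R φ x hφ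
  have hset := stub_capacity_invariant (Percolation.rectQuad 0 w 0 h hw hh) R ψ h0 h2 h0' h2'
  have hrect := stub_rectCapacity w h hw hh
  rw [hset] at hrect
  rw [hrect, inv_div, hlam]
  exact ⟨by positivity, rfl⟩

/-- Transport of the cross-ratio across two presentations with the same carrier and the same
marked points (`IsUniformizing` only sees `carrier` and `pt`).
[cite: AhlforsBers1960, Thm. 11 (analytic dependence of the modulus; here via the Dirichlet principle — bookkeeping)] -/
theorem crossRatio_eq_of_carrier_eq {R D : ConformalRectangle} (hc : R.carrier = D.carrier)
    (hp : ∀ i, R.pt i = D.pt i)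
    {φ : ConformalEquiv upperHalfPlaneSet R.carrier} {x : Fin 4 → ℝ} (h : R.IsUniformizing φ x)
    {ψ : ConformalEquiv upperHalfPlaneSet D.carrier} {y : Fin 4 → ℝ} (h' : D.IsUniformizing ψ y) :
    RandomPlanarGeometry.crossRatio x = RandomPlanarGeometry.crossRatio y := by
  -- adapted from the crux disprover's `crossRatio_eq_of_carrier_eq` (Cruxes/SegmentOpen/Disproof.lean)
  have key : ∀ (S : Set ℂ) (hS : S = D.carrier) (φ' : ConformalEquiv upperHalfPlaneSet S),
      ((StrictMono x ∨ StrictAnti x) ∧ ∀ i, φ'.HasBoundaryValue (x i) (R.pt i)) →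
        RandomPlanarGeometry.crossRatio x = RandomPlanarGeometry.crossRatio y := by
    intro S hS φ' hφ'
    subst hS
    have hu : D.IsUniformizing φ' x := ⟨hφ'.1, fun i => by rw [← hp i]; exact hφ'.2 i⟩
    exact RandomPlanarGeometry.ConformalRectangle.crossRatio_eq_of_isUniformizing_holds hu h'
  exact key R.carrier hc φ h

/-- SH + the above, for the sheared quad: for `0 < im α` the shear energy `E_{R'}(α)` (infimum of
the `α`-anisotropic energies of the admissible class of `R'`) is positive, and every presentation
`(R, φ, x)` of `φ_α R'` has cross-ratio `λ(i / E_{R'}(α))`.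
[cite: AhlforsBers1960, Thm. 11 (analytic dependence of the modulus; here via the Dirichlet principle — bookkeeping)] -/
theorem crossRatio_shear_eq_lamR (R' : ConformalRectangle) {α : ℂ} (hα : 0 < α.im) :
    0 < sInf {e : ℝ | ∃ U : ℂ → ℝ,
          (ContDiffOn ℝ 1 U R'.carrier ∧
            IntegrableOn (fun z => ‖fderiv ℝ U z‖ ^ 2) R'.carrier ∧
            (∃ O : Set ℂ, IsOpen O ∧ R'.arc 0 ⊆ O ∧ ∀ z ∈ O ∩ R'.carrier, U z = 0) ∧
            (∃ O : Set ℂ, IsOpen O ∧ R'.arc 2 ⊆ O ∧ ∀ z ∈ O ∩ R'.carrier, U z = 1)) ∧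
          e = ∫ z in R'.carrier, (α.im * (fderiv ℝ U z 1) ^ 2 +
            (fderiv ℝ U z Complex.I - α.re * fderiv ℝ U z 1) ^ 2 / α.im)} ∧
      ∀ (R : ConformalRectangle) (φ : ConformalEquiv upperHalfPlaneSet R.carrier) (x : Fin 4 → ℝ),
        R.carrier = moduliShear α '' R'.carrier → (∀ i, R.pt i = moduliShear α (R'.pt i)) →
        R.IsUniformizing φ x →
        RandomPlanarGeometry.crossRatio x = RandomPlanarGeometry.KlebanZagier.lamR
          (sInf {e : ℝ | ∃ U : ℂ → ℝ,
            (ContDiffOn ℝ 1 U R'.carrier ∧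
              IntegrableOn (fun z => ‖fderiv ℝ U z‖ ^ 2) R'.carrier ∧
              (∃ O : Set ℂ, IsOpen O ∧ R'.arc 0 ⊆ O ∧ ∀ z ∈ O ∩ R'.carrier, U z = 0) ∧
              (∃ O : Set ℂ, IsOpen O ∧ R'.arc 2 ⊆ O ∧ ∀ z ∈ O ∩ R'.carrier, U z = 1)) ∧
            e = ∫ z in R'.carrier, (α.im * (fderiv ℝ U z 1) ^ 2 +
              (fderiv ℝ U z Complex.I - α.re * fderiv ℝ U z 1) ^ 2 / α.im)})⁻¹ := by
  set Q : ConformalRectangle := R'.map (shearHomeomorph α hα.ne') with hQ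
  obtain ⟨φQ, xQ, hQu⟩ := MarkedDomain.exists_isUniformizing_holds Q
  obtain ⟨hpos, hcr⟩ := crossRatio_eq_lamR_inv_cap Q φQ xQ hQu
  rw [hQ, stub_shearCapacity_eq R' α hα] at hpos hcr
  refine ⟨hpos, fun R φ x hc hp hφ => ?_⟩
  rw [← hcr]
  refine crossRatio_eq_of_carrier_eq ?_ ?_ hφ hQu
  · rw [hc, hQ, MarkedDomain.carrier_map, coe_shearHomeomorph]
  · intro i
    rw [hp i, hQ, MarkedDomain.pt_map, coe_shearHomeomorph]

end ShearCrossRatioAnalyticProof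

open ShearCrossRatioAnalyticProof in
/-- **S7 of line `Sketch`, PROVED (Dirichlet-principle route)**: for every conformal rectangle `R'`
there is `M : ℂ → ℝ`, real-analytic on `{α | 0 < im α}`, such that every uniformizing datum of every
presentation of the sheared quad `φ_α R'` has Cardy cross-ratio `M α` — namely
`M α = λ(i / E_{R'}(α))`, `E_{R'}` the shear energy of AN. Composition of the five landed stubs
RU, DPinv, DPrect, SH, AN with `analyticAt_lamR`.
[cite: AhlforsBers1960, Thm. 11 (analytic dependence of the modulus; here via the Dirichlet principle — bookkeeping)] -/
theorem stub_shearCrossRatioAnalytic :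
    ∀ R' : ConformalRectangle, ∃ M : ℂ → ℝ, AnalyticOnNhd ℝ M {α : ℂ | 0 < α.im} ∧
      ∀ α : ℂ, 0 < α.im → ∀ (R : ConformalRectangle)
        (φ : ConformalEquiv UpperHalfPlane.upperHalfPlaneSet R.carrier) (x : Fin 4 → ℝ),
        R.carrier = moduliShear α '' R'.carrier → (∀ i, R.pt i = moduliShear α (R'.pt i)) →
        R.IsUniformizing φ x → RandomPlanarGeometry.crossRatio x = M α := by
  intro R'
  set E : ℂ → ℝ := fun α => sInf {e : ℝ | ∃ U : ℂ → ℝ,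
      (ContDiffOn ℝ 1 U R'.carrier ∧
        IntegrableOn (fun z => ‖fderiv ℝ U z‖ ^ 2) R'.carrier ∧
        (∃ O : Set ℂ, IsOpen O ∧ R'.arc 0 ⊆ O ∧ ∀ z ∈ O ∩ R'.carrier, U z = 0) ∧
        (∃ O : Set ℂ, IsOpen O ∧ R'.arc 2 ⊆ O ∧ ∀ z ∈ O ∩ R'.carrier, U z = 1)) ∧
      e = ∫ z in R'.carrier, (α.im * (fderiv ℝ U z 1) ^ 2 +
        (fderiv ℝ U z Complex.I - α.re * fderiv ℝ U z 1) ^ 2 / α.im)} with hE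
  refine ⟨fun α => RandomPlanarGeometry.KlebanZagier.lamR (E α)⁻¹, ?_, ?_⟩
  · intro α hα
    have hEa : AnalyticAt ℝ E α := stub_shearEnergyAnalytic R' α hα
    have hpos : 0 < E α := (crossRatio_shear_eq_lamR R' hα).1
    have hinv : AnalyticAt ℝ (fun β => (E β)⁻¹) α := hEa.inv hpos.ne'
    exact AnalyticAt.comp (g := RandomPlanarGeometry.KlebanZagier.lamR)
      (f := fun β => (E β)⁻¹) (x := α)
      (RandomPlanarGeometry.analyticAt_lamR (inv_pos.2 hpos)) hinv
  · intro α hα R φ x hc hp hφ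
    exact (crossRatio_shear_eq_lamR R' hα).2 R φ x hc hp hφ

end Literature.Probability.RandomPlanarGeometry.ShearModulus

end Part6

/-! ## Part 7 — the EXACT discharge `ShearCrossRatioAnalytic_holds` -/

namespace Literature.Probability.RandomPlanarGeometry

/-- **The named fact `ShearCrossRatioAnalytic` HOLDS** (`ShearModulusAnalytic.lean`; Ahlfors–Bers analyticity of the modulus of Beffara's sheared
quadrilateral, here by the Dirichlet principle — no quasiconformal theory).  EXACT-name discharge by
`ShearModulus.stub_shearCrossRatioAnalytic`; Literature-side twin of the Summits-side
`Summit.CriticalPhenomena.CardyFormulaZ2.Theorems.shearCrossRatioAnalytic_holds`. [cite: AhlforsBers1960, Thm. 11] -/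
theorem ShearCrossRatioAnalytic_holds : ShearCrossRatioAnalytic :=
  ShearModulus.stub_shearCrossRatioAnalytic

end Literature.Probability.RandomPlanarGeometry

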